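import Mathlib
import Literature.Geometry.Lorentzian.GiorgiKlainermanSzeftel2022.GRWTransformationAlgebra

/-!
# Giorgi–Klainerman–Szeftel, *Wave equations estimates and the nonlinear stability of slowly rotating Kerr black holes* — App. D.7 ledger: the third-order equation for `A̲₄` behind the gRW equation for `𝔮̲` (proof of Theorem 5.3.7)

Sources, read side by side (the loci of both are given in every docstring):

* `[J]`  E. Giorgi, S. Klainerman, J. Szeftel, *Wave equations estimates and the nonlinear
  stability of slowly rotating Kerr black holes*, Pure Appl. Math. Q. **20** (2024), no. 7
  (doi:10.4310/pamq.241128023033) — Lemma 5.3.6 and Theorem 5.3.7 (file p0201) and Appendix D.7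
  "Proof of Theorem 5.3.7" (file pp. p0876 L46 – p0898 L24: Proposition D.7.1 with (D.7.1)–(D.7.5),
  Proposition D.7.2 with (D.7.6)–(D.7.11), the remark on `W̲₃` and the list of nonlinear terms
  (p0892 L6 – p0893 L77), Proposition D.7.3 (p0893 L78 – p0898 L24)).  **Locator convention (as in
  the siblings `ZCoefficientLedger`, `TeukolskyAbarLedger`): `[J]` pages are the FILE pages `p0NNN`
  of the materialised journal PDF (= printed folio + 1), `Lnn` the line of the text layer of that
  file.**
* `[v1]` the same authors, arXiv:2205.14808 (v1), TeX source lines `l.N`: Lemma `Lemma:teuk-intermiediate`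
  / (5.3.6) l.9155–9175, Theorem `thm-eq-qfb` l.9189–9221, Appendix section `proof:thm-eq-qfb`
  l.35716–36523 (Proposition D.6.1 l.35725–35930, Proposition D.6.2 l.35937–36266, `W̲₃` and the
  nonlinear terms l.36266–36327, Proposition D.6.3 l.36332–36523).  `[v1]` §D.6 = `[J]` §D.7; the
  equation labels correspond as (D.7.1) = `eq:Ab-434`, (D.7.2) = `eq:mathcal-J-434-r-2Gag`,
  (D.7.3) = `eq:mathcal-J-434-r-1Gag`, (D.7.5) = `eq:nabc4-DDbcAb`, (D.7.6) = `eq:nabc4-nabc4-nabc4-Ab4`,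
  (D.7.7) = `eq:nabc4-DDbc-c-Ab4`, (D.7.8) = `eq:ov-mathcal-I`, (D.7.9) = `eq:mathcal-J`,
  (D.7.10) = `eq:mathcal-K`, (D.7.11) = `eq:mathscr-L-Ab`.

## What is transcribed

App. D.7 applies `ᶜ∇₄ + tr X + ½conj tr X` to the Teukolsky equation for `A̲` in the `A̲₄` form
(Proposition 5.3.1, the sibling `TeukolskyAbarLedger`) — Proposition D.7.1, producing (D.7.1) with the
one-form `𝒥₄₃₄` ((D.7.2)/(D.7.3)) and the error `err₄₃₄` (D.7.4) — then `ᶜ∇₄ + 2tr X + ½conj tr X` to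
(D.7.1) — Proposition D.7.2, producing the third-order equation (D.7.6) whose right-hand side is
`¼(ᶜ𝒟 + H + 6H̲)⊗̂(conj𝒟·Q̃ + (H̄ + 2H̲̄)·Q̃) + 3PQ̃ + ℒ[A̲] + err₄₄₃₄` with `Q̃ = Q̃(A̲)` of Lemma 5.3.6
and the lower-order operator `ℒ` of (D.7.11); it then reads off the lowest-order coefficient `W̲₃`
("`Z̲₃ = O(a²r⁻⁵)`"), lists the nonlinear terms, and Proposition D.7.3 shows, term by term (Steps 1–7:
`I₁, S₁, S₂, S₃, J₁, J₂, K₁, L, M`), that `err₄₄₃₄ = r⁻²𝔡^{≤2}((A,B)·Γ_b) + r⁻⁴𝔡^{≤3}(Γ_g·Γ_b)`.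
The whole appendix is coefficient bookkeeping: Leibniz expansions, quoted commutation formulas
((4.2.12)–(4.2.14) in the displayed schematic forms), quoted transport / null-structure / Codazzi /
Bianchi identities, and the collection of like terms.

## How it is typed (the scalar–module shadow of `TeukolskyAbarLedger` §6; nothing tensorial is derived)

* Scalars: an abstract field `K` of characteristic zero (every display carries `½, ¼, ⅛, 3/2, …`).
  §0 fixes the dictionary `y = tr X = tr χ − i⁽ᵃ⁾tr χ`, `yb = conj tr X = tr χ + i⁽ᵃ⁾tr χ` (`[v1]`
  l.9174), `i² = −1`, `w = ⁽ᵃ⁾tr χ²/tr χ`, `κ₁ = (5/2)tr X − conj tr X − 2w` (the coefficient of (5.3.6),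
  `Qtilde_operator_coeff`), `κ₂ = κ₁ + ½conj tr X`, `μ = tr X − conj tr X − 2w`; `C̲₁, C̲₂` are the
  sibling `GRWTransformationAlgebra.C1/C2` BY NAME.  `ᶜ∇₄` acts on scalars through a derivation
  `D : Derivation ℤ K K`; `ᶜ𝒟`, `conj ᶜ𝒟` act on scalars through `Derivation ℤ K M₁` (values in
  one-forms).  The transport values the text uses (`ᶜ∇₄tr X = −½(tr X)² (+ quadratic Γ)`, its
  conjugate, `ᶜ∇₄tr χ = −½(tr χ² − ⁽ᵃ⁾tr χ²)`, `ᶜ∇₄⁽ᵃ⁾tr χ = −tr χ⁽ᵃ⁾tr χ`) are HYPOTHESES of the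
  theorems that need them — quoted, never derived here (in §C they are also discharged on the printed
  outgoing Kerr tables by the sibling's `e4_trch_out`, `e4_atrch_out`).
* Tensors: `K`-modules `M₁` (horizontal one-forms) and `M₂` (symmetric traceless 2-tensors); `⊗̂`
  and the contractions are genuinely `K`-bilinear maps (`M₁ →ₗ[K] M₁ →ₗ[K] M₂`, …), so every bilinear
  expansion is kernel-checked; `ᶜ∇₄` on `M₁`/`M₂` is either the sibling's `CovD D M` (additive with
  the scalar Leibniz rule) or an opaque additive map with the displayed product rule as a hypothesis;
  `ᶜ𝒟⊗̂` is an additive map `M₁ →+ M₂` with the Leibniz rule `𝒟⊗̂(fξ) = f𝒟⊗̂ξ + 𝒟f⊗̂ξ` as a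
  hypothesis.  Every quoted equation (commutator displays for `s = −2, −1, +1` exactly as the proof
  writes them, (D.5.3b), Lemma D.5.1, (equation:nabc_4Hc), the Codazzi equation for `conj𝒟 tr X`,
  the Bianchi identity for `ᶜ∇₄P`, the null structure equation `ᶜ∇₄X̂ + Re(tr X)X̂ = −A`, (5.3.6) in
  the form `ᶜ∇₄A̲₄ = Q̃ − κ₁A̲₄`) enters as a HYPOTHESIS whose schematic remainder (`r⁻ᵏ𝔡Γ`,
  `Γ_g·Γ_b`, "l.o.t.") is an opaque element carried through the identity as an explicit summand —
  never absorbed, never assigned an order.  What the kernel certifies is exactly the displayed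
  coefficient arithmetic; where the kernel's collection differs from a display the theorem states the
  kernel's value and its docstring names the difference.

## Certified (0 sorry, 0 def; every theorem closes by `subst`/`simp only`/`ring`/`module`/`field_simp`/`linear_combination`)

* §0: the `tr X`/`conj tr X` dictionary; the identification of the operator of `[v1]` l.9170 with the
  `κ₁` of (5.3.6); the two scalar chains of `[J]` D.7.2 Step 7 (`half_sq_diff`, `Ab_coefficient`).
* §A (Proposition D.7.1): (D.7.5); the kernel value of `4I` and the displayed `I`; `J`, `K` of Steps
  2–3; the Step-4 sum = (D.7.1) with `𝒥₄₃₄` and the explicit part of (D.7.4); (D.7.3) (the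
  `H`-coefficient of `𝒥₄₃₄` cancels exactly) and (D.7.2).
* §B (Proposition D.7.2): (D.7.7), (D.7.8), `I` of Step 1 with `𝒥`, (D.7.9), (D.7.10), `J, K, L, M`
  of Steps 2–5, the Step-6 sum, the substitution by (D.7.1) giving the shape of (D.7.6) with `ℒ` =
  (D.7.11) literally, the three coefficient facts of Step 6, and Step 7: the `F4`-coefficient, the
  displayed `ᶜ∇₄𝒥₄₃₄` (the two `O(a)` contributions to `H̲` cancel, giving the printed `6(tr X)²H̲`)
  and the `F`-coefficient (`H̲`: `(6/4 − 3/2)(tr X)² = 0`).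
* §C (`W̲₃`): the displayed arithmetic for the `O(a)` part of `Z̲₃` sums to `0`; with the truncated
  transport it leaves `i⁽ᵃ⁾tr χ³`, with the full Kerr transport it vanishes identically (also on the
  sibling's outgoing Kerr tables), and the complete `Z̲₃` built from `C̲₁, C̲₂` of (5.3.3) has every
  term carrying `⁽ᵃ⁾tr χ²` (`Zb3_exact`).
* §D (Proposition D.7.3): every displayed regrouping of Steps 1, 1a, 1b, 1c, 2, 3, 5, 6 as an EXACT
  module identity, the terms the displays leave inside `r⁻ᵏ𝔡(Γ·Γ)` appearing as explicit summands —
  in each case an explicit multiple of `conj tr X − tr X = 2i⁽ᵃ⁾tr χ` (or of `conj𝒟 tr X`) plus the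
  opaque remainders of the quoted inputs; the per-term computations are blind to the numerical
  coefficients of `err_TE` (`D73_coefficient_free`), and the images of the sibling's extra `B̲⊗̂B̲`
  (its print datum 4) under the two operators are computed (`D73_BB_first/second/residue`).

## Print data found by the kernel / by collation (offered to the cell's census, not rulings)

1. `[v1]` l.35823–35829 = `[J]` p0879 L84–104: in the display "`4I = …`" the last five terms carry
   `¼, ½, −⅛, −⅛, −⅛`, i.e. the coefficients of `I`; the kernel's `4I` has `1, 2, −½, −½, −½`
   (`D71_fourI`) and the following display "`I = …`" is as printed (`D71_I`).  Both texts; no effect.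
2. `[v1]` l.36244 = `[J]` p0891 L75: "`½(tr X − conj tr X)² = −2i(⁽ᵃ⁾tr χ)²`"; the value is
   `−2(⁽ᵃ⁾tr χ)²` (`half_sq_diff`).  Both texts; the stated order `O(r⁻⁴)` is unaffected.
3. `[v1]` l.36398 = `[J]` p0895 L43 (Step 1c): the bracket `(ᶜ∇₄B̲ + 2tr X B̲)` where the quantity that
   is `r⁻²Γ_g` — used in Steps 1, 1a, 1b, 2, 3 of the same proof — is `ᶜ∇₄B̲ + tr X B̲`; with `2tr X`
   the exact identity leaves a `(tr X)²`-multiple (`D73_S3_printed_bracket`), with `tr X` an `O(a)` one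
   (`D73_S3`).  Both texts.
4. `[v1]` l.36452 = `[J]` p0896 L69 (Step 3, `K₁`): the bracket `(ᶜ∇₄B̲ + ½tr X B̲)`, eight lines above
   the same term written `(ᶜ∇₄B̲ + tr X B̲)` (l.36460 = p0896 L116); `D73_K1` vs
   `D73_K1_printed_bracket`.  Both texts.
5. `[v1]` l.36457 = `[J]` p0896 L91 labels the second-order quantity of Step 3 "`J₂`" (it is built on
   `K₁`).  Cosmetic, both texts.
6. Readings (schematic coefficients, not defects): (D.7.2) prints `+X̂·Ȟ` where the bookkeeping gives
   `¼X̂·Ȟ` (`D71_J434_r2`); Step 7 prints "`+Im(tr X)Ȟ`" for the kernel's `−¼ i Im(tr X)Ȟ`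
   (`D72_step7_F4coeff`); (D.7.4) multiplies `err_TE` by `(½tr X + conj tr X)` where the operator
   applied is `ᶜ∇₄ + tr X + ½conj tr X` — difference `½(tr X − conj tr X)err_TE` (`D71_errTE_coeff`),
   and Proposition D.7.3 Step 1 follows (D.7.4); the `err₄₃₄`-coefficient of `err₄₄₃₄` is printed as
   `(tr X + (3/2)conj tr X + 2w)` = `(2tr X + ½conj tr X) − μ` (`D72_err434_coeff`); (D.7.3) is derived
   quoting "`𝒟conj tr X = 2i Im(tr X)H + …`" (`[v1]` l.35896) where Lemma D.5.1 has `(H − Ȟ)` — the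
   `Ȟ`-part is `r⁻¹Γ_g` there; `ᶜ∇₄𝒥₄₃₄` is computed with the scalar commutator in its `s = 1` form as
   displayed (`[v1]` l.36215–36222).  `[J]`'s text layer drops under-bars and most accents, so
   glyph-level distinctions (`X̂/X̲̂`, `H/Ȟ`, bars) are read on `[v1]` only.

## Not claimed

No tensorial statement, commutation formula, Bianchi, null-structure or transport equation is
derived; the decay classes `Γ_g, Γ_b`, the symbols `r⁻ᵏ𝔡^{≤j}`, `O(a^k r^{-n})` and every absorption
of a term into them are outside the model and are mentioned in docstrings only as the text's words;
in particular the conclusions "`Sⱼ, J₂, K₂, L, M = r⁻⁴𝔡^{≤3}(Γ_g·Γ_b) + …`" are NOT kernel statements —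
the kernel exhibits the exact leftover terms and their scalar coefficients, nothing more.  Nothing
here is a hypothesis-fact of `[J]`; no `def … : Prop`.  This module is a typed reading aid for the
cell's census of `[J]` ch. 5 / App. D, not progress on any summit.
-/

namespace Literature.Geometry.Lorentzian.GiorgiKlainermanSzeftel2022.TeukolskyQfbLedger

open Literature.Geometry.Lorentzian.GiorgiKlainermanSzeftel2022.GRWTransformationAlgebra

variable {K : Type*} [Field K]

/-! ## §0 Scalar dictionary and helpers

Cast of scalars (all elements of the field `K`): `i` with `i² = −1`; `t = tr χ`, `ta = ⁽ᵃ⁾tr χ`;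
`y = tr X = tr χ − i ⁽ᵃ⁾tr χ`, `yb = conj(tr X) = tr χ + i ⁽ᵃ⁾tr χ` (`[v1]` l.9174 "the fact that
`conj(tr X) = tr χ + i ⁽ᵃ⁾tr χ`", `[J]` p0201 L44–47), so that `Im(tr X) = −⁽ᵃ⁾tr χ` and
`i Im(tr X) = ½(tr X − conj tr X)`; `w = ⁽ᵃ⁾tr χ²/tr χ`; `p = P`. -/

/-- A module-valued derivation kills numerals (used for `ᶜ𝒟`, `conj(ᶜ𝒟)` acting on scalars). [folklore] -/
theorem Dv_ofNat {M : Type*} [AddCommGroup M] [Module K M] (Dh : Derivation ℤ K M) (k : ℕ)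
    [k.AtLeastTwo] : Dh (OfNat.ofNat k : K) = 0 := by
  rw [← Nat.cast_ofNat]; exact Dh.map_natCast _

/-- The numeral quotients met below are killed by any derivation. [folklore] -/
theorem Dv_num {M : Type*} [AddCommGroup M] [Module K M] (Dh : Derivation ℤ K M) :
    Dh (2 : K) = 0 ∧ Dh (4 : K) = 0 ∧ Dh (5 : K) = 0 ∧ Dh ((1 : K) / 2) = 0 ∧ Dh ((5 : K) / 2) = 0 ∧
    Dh ((3 : K) / 2) = 0 := by
  have h2 : Dh (2 : K) = 0 := Dv_ofNat Dh 2
  refine ⟨h2, Dv_ofNat Dh 4, Dv_ofNat Dh 5, ?_, ?_, ?_⟩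
  · rw [Dh.leibniz_div_const _ _ h2, Dh.map_one_eq_zero, smul_zero]
  · rw [Dh.leibniz_div_const _ _ h2, Dv_ofNat Dh 5, smul_zero]
  · rw [Dh.leibniz_div_const _ _ h2, Dv_ofNat Dh 3, smul_zero]

/-- The `tr X` / `conj(tr X)` dictionary: with `tr X = tr χ − i ⁽ᵃ⁾tr χ`, `conj tr X = tr χ + i ⁽ᵃ⁾tr χ`
one has `tr X + conj tr X = 2 tr χ`, `tr X − conj tr X = −2i ⁽ᵃ⁾tr χ` (so `i Im(tr X) = ½(tr X − conj tr X)`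
with `Im(tr X) = −⁽ᵃ⁾tr χ`), `(tr X − conj tr X)² = −4 ⁽ᵃ⁾tr χ²` and `½(tr X + conj tr X) = Re(tr X) = tr χ`.
[cite: GiorgiKlainermanSzeftel2024, p0201 L44–47; GiorgiKlainermanSzeftel2022, l.9174] -/
theorem trX_dictionary [CharZero K] (i t ta y yb : K) (hi : i ^ 2 = -1) (hy : y = t - i * ta)
    (hyb : yb = t + i * ta) :
    y + yb = 2 * t ∧ y - yb = -(2 * i * ta) ∧ i * (-ta) = 1 / 2 * (y - yb) ∧
    (y - yb) ^ 2 = -(4 * ta ^ 2) ∧ 1 / 2 * (y + yb) = t := by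
  subst hy hyb
  refine ⟨by ring, by ring, by ring, ?_, by ring⟩
  linear_combination (4 * ta ^ 2) * hi

/-- `[J]` Lemma 5.3.6 / `[v1]` Lemma l.9155–9175: the coefficient identity behind "which together with
the fact that `conj tr X = tr χ + i ⁽ᵃ⁾tr χ` … proves the lemma":
`(3/2) tr X − 2⁽ᵃ⁾tr χ²/tr χ − 2i ⁽ᵃ⁾tr χ = (5/2) tr X − conj tr X − 2⁽ᵃ⁾tr χ²/tr χ`, i.e. the operator of
Lemma 12.x quoted at `[v1]` l.9170 equals the one defining `Q̃(A̲)` in (5.3.6).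
[cite: GiorgiKlainermanSzeftel2024, Lemma 5.3.6 p0201 L5–47; GiorgiKlainermanSzeftel2022, l.9155–9175] -/
theorem Qtilde_operator_coeff [CharZero K] (i t ta y yb w : K) (hy : y = t - i * ta) (hyb : yb = t + i * ta) :
    3 / 2 * y - 2 * w - 2 * i * ta = 5 / 2 * y - yb - 2 * w := by
  subst hy hyb; ring

/-- Step 7 of the proof of `[J]` Proposition D.7.2, "Observe that
`½(tr X)² − conj(tr X) tr X + ½(conj tr X)² = ½(tr X − conj tr X)² = −2i(⁽ᵃ⁾tr χ)² = O(r⁻⁴)`":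
the kernel's value of the middle expression is `−2(⁽ᵃ⁾tr χ)²` (REAL; both texts print a factor `i`,
which does not affect the stated order `O(r⁻⁴)`).  The second conjunct records the gap to the
printed value.
[cite: GiorgiKlainermanSzeftel2024, p0891 L75; GiorgiKlainermanSzeftel2022, l.36244] -/
theorem half_sq_diff [CharZero K] (i t ta y yb : K) (hi : i ^ 2 = -1) (hy : y = t - i * ta) (hyb : yb = t + i * ta) :
    (1 / 2 * y ^ 2 - yb * y + 1 / 2 * yb ^ 2 = 1 / 2 * (y - yb) ^ 2 ∧
      1 / 2 * (y - yb) ^ 2 = -(2 * ta ^ 2)) ∧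
    1 / 2 * (y - yb) ^ 2 - (-(2 * i * ta ^ 2)) = 2 * (i - 1) * ta ^ 2 := by
  subst hy hyb
  refine ⟨⟨by ring, ?_⟩, ?_⟩
  · linear_combination (2 * ta ^ 2) * hi
  · linear_combination (2 * ta ^ 2) * hi

/-- Step 7 of the proof of `[J]` Proposition D.7.2, "The term in `A̲`": with
`μ = tr X − conj tr X − 2⁽ᵃ⁾tr χ²/tr χ`,
`μ(½ conj tr X − tr X) + ½ tr X (tr X − conj tr X) = −½(tr X − conj tr X)² − 2(⁽ᵃ⁾tr χ²/tr χ)(½ conj tr X − tr X)`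
`= 2⁽ᵃ⁾tr χ² − 2(⁽ᵃ⁾tr χ²/tr χ)(−½ tr χ + (3/2) i ⁽ᵃ⁾tr χ) = 3 ⁽ᵃ⁾tr χ² (1 − i ⁽ᵃ⁾tr χ/tr χ)`, as printed
(the factor `3P` is common).
[cite: GiorgiKlainermanSzeftel2024, p0892 L1–5 (display ending Step 7); GiorgiKlainermanSzeftel2022, l.36250–36256] -/
theorem Ab_coefficient [CharZero K] (i t ta y yb : K) (hi : i ^ 2 = -1) (ht : t ≠ 0) (hy : y = t - i * ta)
    (hyb : yb = t + i * ta) :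
    (y - yb - 2 * (ta ^ 2 / t)) * (1 / 2 * yb - y) + 1 / 2 * y * (y - yb)
        = -(1 / 2) * (y - yb) ^ 2 - 2 * (ta ^ 2 / t) * (1 / 2 * yb - y) ∧
      -(1 / 2) * (y - yb) ^ 2 - 2 * (ta ^ 2 / t) * (1 / 2 * yb - y)
        = 2 * ta ^ 2 - 2 * (ta ^ 2 / t) * (-(1 / 2) * t + 3 / 2 * i * ta) ∧
      2 * ta ^ 2 - 2 * (ta ^ 2 / t) * (-(1 / 2) * t + 3 / 2 * i * ta)
        = 3 * ta ^ 2 * (1 - i * ta / t) := by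
  subst hy hyb
  refine ⟨by ring, ?_, ?_⟩
  · linear_combination (-2 * ta ^ 2) * hi
  · field_simp
    ring

/-! ## §A `[J]` Proposition D.7.1 = `[v1]` Proposition D.6.1 (`prop:appendix-nabc43Ab4`) -/

section PropD71

variable {M₁ M₂ : Type*} [AddCommGroup M₁] [Module K M₁] [AddCommGroup M₂] [Module K M₂]

/-- Step 1, the one-form `∇₄F`, `F = conj𝒟·A̲ + H̄·A̲` — (D.7.5) = `[v1]` (eq:nabc4-DDbcAb).
Inputs (hypotheses, quoted): the commutator display "`[ᶜ∇₄, conj𝒟·]A̲ = −½conj(tr X) conj𝒟·A̲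
+ H̲̄·ᶜ∇₄A̲ + 4B̄·A̲ − ½X̂·conj𝒟A̲ + l.o.t.`" (`hcomm`, with `ᶜ∇₄A̲ = A̲₄ − ½ tr X A̲`, `hA4`), the Leibniz
rule of `conj𝒟·` (`hLeib`: `conj𝒟·(A̲₄ − ½tr X A̲) = conj𝒟·A̲₄ − ½tr X conj𝒟·A̲ − ½(conj𝒟 tr X)·A̲`),
the Leibniz rule of the contraction (`hHA`), "`ᶜ∇₄H̄ = −½tr X(H̄ − H̲̄) − B̄`" (`hn4H`) and the Codazzi
equation "`conj𝒟 tr X = −(tr X − conj tr X)H̄ + 2B̄ + 𝒟·conj X̂ + r⁻²Γ_g`" (`hcod`).  Output: (D.7.5) with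
the printed coefficients `1, (H̄+H̲̄), −½(tr X + conj tr X), +2, −½, −½`; schematic remainders are
carried as the bracket `g₁ + g₂·A̲ − ½g₃·A̲`.
[cite: GiorgiKlainermanSzeftel2024, p0877 L69–p0878 L125; GiorgiKlainermanSzeftel2022, l.35763–35809] -/
theorem D71_nab4F [CharZero K] (dot : M₁ →ₗ[K] M₂ →ₗ[K] M₁) (y yb : K) (Ab A4 n4Ab : M₂)
    (n4F n4cDA n4HA cDn4A cDA cDA4 cDy XcDA DX Hbar Hbbar n4Hbar Bbar g₁ g₂ g₃ : M₁)
    (hF : n4F = n4cDA + n4HA)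
    (hcomm : n4cDA = cDn4A - (1 / 2 * yb) • cDA + dot Hbbar n4Ab + (4 : K) • dot Bbar Ab
      - (1 / 2 : K) • XcDA + g₁)
    (hA4 : n4Ab = A4 - (1 / 2 * y) • Ab)
    (hLeib : cDn4A = cDA4 - (1 / 2 * y) • cDA - (1 / 2 : K) • dot cDy Ab)
    (hHA : n4HA = dot n4Hbar Ab + dot Hbar n4Ab)
    (hn4H : n4Hbar = -((1 / 2 * y) • (Hbar - Hbbar)) - Bbar + g₂)
    (hcod : cDy = -((y - yb) • Hbar) + (2 : K) • Bbar + DX + g₃) :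
    n4F = cDA4 + dot (Hbar + Hbbar) A4 - (1 / 2 * (y + yb)) • (cDA + dot Hbar Ab)
      + (2 : K) • dot Bbar Ab - (1 / 2 : K) • XcDA - (1 / 2 : K) • dot DX Ab
      + (g₁ + dot g₂ Ab - (1 / 2 : K) • dot g₃ Ab) := by
  subst hF hcomm hA4 hLeib hHA hn4H hcod
  simp only [map_add, map_sub, map_neg, map_smul, LinearMap.add_apply, LinearMap.sub_apply,
    LinearMap.neg_apply, LinearMap.smul_apply]
  module

/-- Step 1, `4I := ᶜ∇₄(𝒟⊗̂F) + (tr X + ½conj tr X)𝒟⊗̂F` (`F = conj𝒟·A̲ + H̄·A̲`,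
`G = conj𝒟·A̲₄ + (H̄+H̲̄)·A̲₄`).  Inputs: the commutator display for `s = −2`,
"`[ᶜ∇₄, 𝒟⊗̂]F = H̲⊗̂ᶜ∇₄F − ½tr X(𝒟⊗̂F + 3H̲⊗̂F) + B⊗̂(conj𝒟·A̲) − ½X̂·conj𝒟(conj𝒟·A̲) + l.o.t.`"
(`hcomm`), (D.7.5) (`h75`) and the Leibniz rule `𝒟⊗̂(fξ) = f𝒟⊗̂ξ + 𝒟f⊗̂ξ` (`hDL`).  Output: the
KERNEL value of `4I` — the last five displayed terms carry the coefficients `1, 2, −½, −½, −½`;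
both texts print them already divided by four (`¼, ½, −⅛, −⅛, −⅛`) in the `4I` display, while the
next display "`I = …`" is `¼` of the kernel value (theorem `D71_I`).
[cite: GiorgiKlainermanSzeftel2024, p0879 L47–140; GiorgiKlainermanSzeftel2022, l.35810–35843] -/
theorem D71_fourI [CharZero K] (hot : M₁ →ₗ[K] M₁ →ₗ[K] M₂) (Dhat : M₁ →+ M₂) (Dh : Derivation ℤ K M₁)
    (y yb : K) (F G BA XcDA DXA G₁ Hb B cDA n4F : M₁) (n4DhF XcDcDA g₄ : M₂)
    (hDL : ∀ (f : K) (u : M₁), Dhat (f • u) = f • Dhat u + hot (Dh f) u)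
    (hcomm : n4DhF = Dhat n4F + hot Hb n4F - (1 / 2 * y) • (Dhat F + (3 : K) • hot Hb F)
      + hot B cDA - (1 / 2 : K) • XcDcDA + g₄)
    (h75 : n4F = G - (1 / 2 * (y + yb)) • F + (2 : K) • BA - (1 / 2 : K) • XcDA - (1 / 2 : K) • DXA + G₁) :
    n4DhF + (y + 1 / 2 * yb) • Dhat F
      = Dhat G + hot Hb G - (1 / 2 : K) • hot (Dh (y + yb)) F - (1 / 2 * (4 * y + yb)) • hot Hb F
        + hot B cDA + (2 : K) • Dhat BA - (1 / 2 : K) • XcDcDA - (1 / 2 : K) • Dhat XcDA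
        - (1 / 2 : K) • Dhat DXA
        + (Dhat G₁ + hot Hb G₁ + (2 : K) • hot Hb BA - (1 / 2 : K) • hot Hb XcDA
          - (1 / 2 : K) • hot Hb DXA + g₄) := by
  obtain ⟨h2, -, -, hhalf, -⟩ := Dv_num Dh
  subst hcomm h75
  simp only [map_add, map_sub, hDL, map_smul, Dh.leibniz, h2, hhalf, smul_zero, add_zero,
    map_zero, LinearMap.zero_apply, LinearMap.add_apply, LinearMap.smul_apply]
  module

/-- Step 1, the displayed `I` (`= ¼ · 4I`): "`I = ¼(𝒟 + H̲)⊗̂G − ⅛(𝒟(tr X + conj tr X) + (4tr X +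
conj tr X)H̲)⊗̂F + ¼B⊗̂(conj𝒟·A̲) + ½𝒟⊗̂(B̄·A̲) − ⅛X̂·conj𝒟(conj𝒟·A̲) − ⅛𝒟⊗̂(X̂·conj𝒟A̲)
− ⅛𝒟⊗̂((𝒟·conj X̂)·A̲) + l.o.t.`", from the kernel value of `4I` (`D71_fourI`, hypothesis `h4I`
with its schematic bracket abbreviated `S`).
[cite: GiorgiKlainermanSzeftel2024, p0879 L120–140; GiorgiKlainermanSzeftel2022, l.35832–35837] -/
theorem D71_I [CharZero K] (hot : M₁ →ₗ[K] M₁ →ₗ[K] M₂) (Dhat : M₁ →+ M₂) (y yb : K)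
    (F G BA XcDA DXA Hb B cDA Dyyb : M₁) (fourI XcDcDA S : M₂)
    (h4I : fourI = Dhat G + hot Hb G - (1 / 2 : K) • hot Dyyb F - (1 / 2 * (4 * y + yb)) • hot Hb F
        + hot B cDA + (2 : K) • Dhat BA - (1 / 2 : K) • XcDcDA - (1 / 2 : K) • Dhat XcDA
        - (1 / 2 : K) • Dhat DXA + S) :
    (1 / 4 : K) • fourI
      = (1 / 4 : K) • (Dhat G + hot Hb G) - (1 / 8 : K) • hot (Dyyb + (4 * y + yb) • Hb) F
        + (1 / 4 : K) • hot B cDA + (1 / 2 : K) • Dhat BA - (1 / 8 : K) • XcDcDA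
        - (1 / 8 : K) • Dhat XcDA - (1 / 8 : K) • Dhat DXA + (1 / 4 : K) • S := by
  subst h4I
  simp only [map_add, map_smul, LinearMap.add_apply, LinearMap.smul_apply]
  module

/-- Step 2, `J := ¼(H + 4H̲)⊗̂ᶜ∇₄F + ¼ᶜ∇₄(H + 4H̲)⊗̂F + ¼(tr X + ½conj tr X)(H + 4H̲)⊗̂F`
(product rule `hprod` applied to `¼ᶜ∇₄((H + 4H̲)⊗̂F)`), with (D.7.5) inserted:
"`J = ¼(H + 4H̲)⊗̂G + (¼ᶜ∇₄(H + 4H̲) + ⅛tr X(H + 4H̲))⊗̂F + r⁻³𝔡(Γ_g·Γ_b)`" — the last bracket is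
the kernel's explicit remainder `¼(H + 4H̲)⊗̂(2B̄·A̲ − ½X̂·conj𝒟A̲ − ½(𝒟·conj X̂)·A̲ + l.o.t.)`.
[cite: GiorgiKlainermanSzeftel2024, p0880 L5–62; GiorgiKlainermanSzeftel2022, l.35840–35852] -/
theorem D71_J [CharZero K] (hot : M₁ →ₗ[K] M₁ →ₗ[K] M₂) (n4₁ : M₁ →+ M₁) (n4₂ : M₂ →+ M₂) (y yb : K)
    (F G BA XcDA DXA G₁ H Hb : M₁) (J : M₂)
    (hprod : ∀ u v, n4₂ (hot u v) = hot (n4₁ u) v + hot u (n4₁ v))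
    (hJ : J = (1 / 4 : K) • n4₂ (hot (H + (4 : K) • Hb) F)
      + (1 / 4 * (y + 1 / 2 * yb)) • hot (H + (4 : K) • Hb) F)
    (h75 : n4₁ F = G - (1 / 2 * (y + yb)) • F + (2 : K) • BA - (1 / 2 : K) • XcDA - (1 / 2 : K) • DXA + G₁) :
    J = (1 / 4 : K) • hot (H + (4 : K) • Hb) G
      + hot ((1 / 4 : K) • n4₁ (H + (4 : K) • Hb) + (1 / 8 * y) • (H + (4 : K) • Hb)) F
      + (1 / 4 : K) • hot (H + (4 : K) • Hb)
          ((2 : K) • BA - (1 / 2 : K) • XcDA - (1 / 2 : K) • DXA + G₁) := by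
  subst hJ
  rw [hprod, h75]
  simp only [map_add, map_sub, map_smul, LinearMap.add_apply, LinearMap.smul_apply]
  module

/-- Step 3, `K := 3ᶜ∇₄(PA̲) + 3(tr X + ½conj tr X)PA̲`, with "`ᶜ∇₄P − ½𝒟·B̄ = −(3/2)tr X P + H̲·B̄ −
¼X̲̂·Ā`" (`hDP`; the three scalars `𝒟·B̄`, `H̲·B̄`, `X̲̂·Ā` are opaque) and `ᶜ∇₄A̲ = A̲₄ − ½tr X A̲`:
"`K = 3PA̲₄ + 3(½conj tr X − tr X)PA̲ + (3/2)(𝒟·B̄)A̲ + r⁻³(Γ_g·Γ_b) + X̲̂·A̲·A`" (the last two are the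
kernel's `(3H̲·B̄ − ¾X̲̂·Ā)A̲`).
[cite: GiorgiKlainermanSzeftel2024, p0880 L63–104; GiorgiKlainermanSzeftel2022, l.35856–35867] -/
theorem D71_K [CharZero K] (D : Derivation ℤ K K) (N4 : CovD D M₂) (y yb p dB HbB XA : K) (Ab A4 : M₂)
    (hDP : D p = -(3 / 2) * y * p + 1 / 2 * dB + HbB - 1 / 4 * XA)
    (hA4 : N4.op Ab = A4 - (1 / 2 * y) • Ab) :
    (3 : K) • N4.op (p • Ab) + (3 * (y + 1 / 2 * yb) * p) • Ab
      = (3 * p) • A4 + (3 * (1 / 2 * yb - y) * p) • Ab + (3 / 2 * dB) • Ab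
        + (3 * HbB - 3 / 4 * XA) • Ab := by
  rw [N4.leibniz, hDP, hA4]
  module

/-- Step 4, "Summing all terms": with `I`, `J`, `K` in the forms of Steps 1–3 (`hI`, `hJ`, `hK`,
schematic brackets `S_I`, `S_J`, `S_K`), `I + J + K = ¼(𝒟 + H + 5H̲)⊗̂G + 3PA̲₄ + 3(½conj tr X − tr X)PA̲
+ 𝒥₄₃₄⊗̂F + err₄₃₄` where `𝒥₄₃₄ := ¼ᶜ∇₄(H + 4H̲) + ⅛tr X(H + 4H̲) − ⅛(𝒟(tr X + conj tr X) +
(4tr X + conj tr X)H̲)` and the explicit part of `err₄₃₄` (D.7.4) is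
`¼B⊗̂conj𝒟·A̲ + ½𝒟⊗̂(B̄·A̲) + (3/2)(𝒟·B̄)A̲ − ⅛X̂·conj𝒟(conj𝒟·A̲) − ⅛𝒟⊗̂(X̂·conj𝒟A̲) − ⅛𝒟⊗̂((𝒟·conj X̂)·A̲)`
— (D.7.1) with the printed coefficients.
[cite: GiorgiKlainermanSzeftel2024, (D.7.1)–(D.7.4) p0876 L51–p0877 L40, p0880 L105–p0882 L52; GiorgiKlainermanSzeftel2022, l.35725–35747, l.35875–35891] -/
theorem D71_sum [CharZero K] (hot : M₁ →ₗ[K] M₁ →ₗ[K] M₂) (Dhat : M₁ →+ M₂) (y yb p dB : K)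
    (F G BA XcDA DXA H Hb B cDA Dyyb n4H4 : M₁) (I J Kt XcDcDA S_I S_J Ab A4 S_K : M₂)
    (hI : I = (1 / 4 : K) • (Dhat G + hot Hb G) - (1 / 8 : K) • hot (Dyyb + (4 * y + yb) • Hb) F
        + (1 / 4 : K) • hot B cDA + (1 / 2 : K) • Dhat BA - (1 / 8 : K) • XcDcDA
        - (1 / 8 : K) • Dhat XcDA - (1 / 8 : K) • Dhat DXA + S_I)
    (hJ : J = (1 / 4 : K) • hot (H + (4 : K) • Hb) G
        + hot ((1 / 4 : K) • n4H4 + (1 / 8 * y) • (H + (4 : K) • Hb)) F + S_J)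
    (hK : Kt = (3 * p) • A4 + (3 * (1 / 2 * yb - y) * p) • Ab + (3 / 2 * dB) • Ab + S_K) :
    I + J + Kt
      = (1 / 4 : K) • (Dhat G + hot (H + (5 : K) • Hb) G) + (3 * p) • A4
        + (3 * (1 / 2 * yb - y) * p) • Ab
        + hot ((1 / 4 : K) • n4H4 + (1 / 8 * y) • (H + (4 : K) • Hb)
            - (1 / 8 : K) • (Dyyb + (4 * y + yb) • Hb)) F
        + ((1 / 4 : K) • hot B cDA + (1 / 2 : K) • Dhat BA + (3 / 2 * dB) • Ab
            - (1 / 8 : K) • XcDcDA - (1 / 8 : K) • Dhat XcDA - (1 / 8 : K) • Dhat DXA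
            + S_I + S_J + S_K) := by
  subst hI hJ hK
  simp only [map_add, map_sub, map_smul, LinearMap.add_apply, LinearMap.sub_apply,
    LinearMap.smul_apply]
  module

/-- `𝒥₄₃₄` evaluated to (D.7.3) = `[v1]` (eq:mathcal-J-434-r-1Gag): with "`𝒟 conj tr X = 2i Im(tr X)H
+ r⁻¹Γ_g`" (here `2i Im(tr X) = tr X − conj tr X`), "`𝒟 tr X = −2tr X H̲ + r⁻¹Γ_g`",
"`∇₄H̲ + tr X H̲ = r⁻²Γ_g`", "`ᶜ∇₄H = −½conj tr X(H − H̲) − B + Γ_g·Γ_b`" (hypotheses with opaque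
remainders `g`): `𝒥₄₃₄ = −¾ tr X H̲ − ¼B + (remainders)`; the `H`-coefficient cancels exactly
(`−⅛conj tr X + ⅛tr X − ⅛(tr X − conj tr X) = 0`).  The text absorbs `−¼B` into `r⁻¹𝔡Γ_g`.
[cite: GiorgiKlainermanSzeftel2024, (D.7.3) p0877 L10, p0881 L1–60; GiorgiKlainermanSzeftel2022, l.35894–35916] -/
theorem D71_J434_eval [CharZero K] (Dh : Derivation ℤ K M₁) (n4 : M₁ →+ M₁) (y yb : K)
    (H Hb B gH gHb gy gyb : M₁)
    (hn4H : n4 H = -((1 / 2 * yb) • (H - Hb)) - B + gH) (hn4Hb : n4 Hb = -(y • Hb) + gHb)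
    (hDyb : Dh yb = (y - yb) • H + gyb) (hDy : Dh y = -((2 * y) • Hb) + gy) :
    (1 / 4 : K) • n4 (H + (4 : K) • Hb) + (1 / 8 * y) • (H + (4 : K) • Hb)
        - (1 / 8 : K) • (Dh (y + yb) + (4 * y + yb) • Hb)
      = -((3 / 4 * y) • Hb) - (1 / 4 : K) • B
        + ((1 / 4 : K) • gH + gHb - (1 / 8 : K) • (gy + gyb)) := by
  have h4 : n4 ((4 : K) • Hb) = (4 : K) • n4 Hb := by
    rw [show (4 : K) • Hb = Hb + Hb + Hb + Hb by module]; simp only [map_add]; module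
  simp only [map_add, h4, hn4H, hn4Hb, hDyb, hDy]
  module

/-- `𝒥₄₃₄` to accuracy `r⁻²Γ_g` — (D.7.2) = `[v1]` (eq:mathcal-J-434-r-2Gag): with "`ᶜ∇₄H =
−½conj tr X(H − H̲) − B + X̂·Ȟ`" and "`∇₄H̲ = −tr X H̲ + r⁻²Γ_g`" only,
`𝒥₄₃₄ = ¼(−½𝒟(tr X + conj tr X) + ½(tr X − conj tr X)H − 4tr X H̲) − ¼B + ¼X̂·Ȟ + (remainders)`;
the printed display carries `+X̂·Ȟ` with coefficient one (schematic bookkeeping of an `O(εr⁻²)` term;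
the kernel's coefficient is `¼`).
[cite: GiorgiKlainermanSzeftel2024, (D.7.2) p0877 L1–9, p0881 L62–p0882 L52; GiorgiKlainermanSzeftel2022, l.35733–35736, l.35918–35930] -/
theorem D71_J434_r2 [CharZero K] (Dh : Derivation ℤ K M₁) (n4 : M₁ →+ M₁) (y yb : K)
    (H Hb B XhHc gH gHb : M₁)
    (hn4H : n4 H = -((1 / 2 * yb) • (H - Hb)) - B + XhHc + gH) (hn4Hb : n4 Hb = -(y • Hb) + gHb) :
    (1 / 4 : K) • n4 (H + (4 : K) • Hb) + (1 / 8 * y) • (H + (4 : K) • Hb)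
        - (1 / 8 : K) • (Dh (y + yb) + (4 * y + yb) • Hb)
      = (1 / 4 : K) • (-((1 / 2 : K) • Dh (y + yb)) + (1 / 2 * (y - yb)) • H - (4 * y) • Hb)
        - (1 / 4 : K) • B + (1 / 4 : K) • XhHc + ((1 / 4 : K) • gH + gHb) := by
  have h4 : n4 ((4 : K) • Hb) = (4 : K) • n4 Hb := by
    rw [show (4 : K) • Hb = Hb + Hb + Hb + Hb by module]; simp only [map_add]; module
  simp only [map_add, h4, hn4H, hn4Hb]
  module

/-- (D.7.4) multiplies `err_TE` by `(½tr X + conj tr X)` while the operator applied to the Teukolsky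
equation in this proof is `ᶜ∇₄ + tr X + ½conj tr X`; the two first-order coefficients differ by
`½(tr X − conj tr X) = −i⁽ᵃ⁾tr χ` (an `O(a)` multiple of `err_TE`; Proposition D.7.3 Step 1 follows
(D.7.4)).  Reading-level datum.
[cite: GiorgiKlainermanSzeftel2024, (D.7.4) p0877 L16–40, p0877 L69; GiorgiKlainermanSzeftel2022, l.35741, l.35749] -/
theorem D71_errTE_coeff [CharZero K] (i t ta y yb : K) (hy : y = t - i * ta) (hyb : yb = t + i * ta) :
    (y + 1 / 2 * yb) - (1 / 2 * y + yb) = 1 / 2 * (y - yb) ∧ 1 / 2 * (y - yb) = -(i * ta) := by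
  subst hy hyb
  constructor <;> ring

end PropD71

/-! ## §B `[J]` Proposition D.7.2 = `[v1]` Proposition D.6.2 (`prop:appendix-nabc443Ab4`)

Cast: `F4 = conj𝒟·A̲₄ + (H̄+H̲̄)·A̲₄` (the `G` of §A), `Gt = conj𝒟·Q̃ + (H̄+2H̲̄)·Q̃` with
`Q̃ = Q̃(A̲)` of (5.3.6), `κ₁ = (5/2)tr X − conj tr X − 2w`, `κ₂ = κ₁ + ½conj tr X`,
`μ = tr X − conj tr X − 2w`, `w = ⁽ᵃ⁾tr χ²/tr χ`; `IA = 𝓘̄·A̲₄`. -/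

section PropD72

variable {M₁ M₂ : Type*} [AddCommGroup M₁] [Module K M₁] [AddCommGroup M₂] [Module K M₂]

/-- Step 1, the one-form `ᶜ∇₄F4` — (D.7.7) = `[v1]` (eq:nabc4-DDbc-c-Ab4).  Inputs: the `s = −1`
commutator display "`ᶜ∇₄(conj𝒟·A̲₄ + (H̄+H̲̄)·A̲₄) = conj𝒟·(ᶜ∇₄A̲₄) − ½conj tr X(conj𝒟·A̲₄ − H̲̄·A̲₄) +
(H̄ + 2H̲̄)·ᶜ∇₄A̲₄ + ᶜ∇₄(H̄+H̲̄)·A̲₄ + l.o.t.`" (`hcomm`), "`ᶜ∇₄H = −½conj tr X(H − H̲) + r⁻¹Γ_g`",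
"`∇₄H̲ = −tr X H̲ + r⁻²Γ_g`" (conjugated: `hn4H`, `hn4Hb`), (5.3.6) in the form "`ᶜ∇₄A̲₄ = Q̃ − κ₁A̲₄`"
(`hA4`) and the Leibniz rule "`conj𝒟·(Q̃ − κ₁A̲₄) = conj𝒟·Q̃ − κ₁conj𝒟·A̲₄ − (conj𝒟κ₁)·A̲₄`" (`hLeib`).
Output: (D.7.7) with `κ₂ = κ₁ + ½conj tr X` and the one-form
`𝓘̄ = −conj𝒟κ₁ + ½conj tr X H̄ − ½tr X(H̄ − H̲̄) − κ₁H̲̄` exactly as displayed.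
[cite: GiorgiKlainermanSzeftel2024, p0883 L5–p0884 L110; GiorgiKlainermanSzeftel2022, l.35980–36028] -/
theorem D72_nab4F4 [CharZero K] (dot : M₁ →ₗ[K] M₂ →ₗ[K] M₁) (y yb k1 k2 : K) (A4 Qt n4A4 : M₂)
    (n4F4 cDn4A4 cDA4 cDQ cDk1 Hbar Hbbar Ibar g₁ g₂ g₃ : M₁)
    (hcomm : n4F4 = cDn4A4 - (1 / 2 * yb) • (cDA4 - dot Hbbar A4) + dot (Hbar + (2 : K) • Hbbar) n4A4
      + dot ((-((1 / 2 * y) • (Hbar - Hbbar)) + g₂) + (-(yb • Hbbar) + g₃)) A4 + g₁)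
    (hA4 : n4A4 = Qt - k1 • A4) (hk2 : k2 = k1 + 1 / 2 * yb)
    (hLeib : cDn4A4 = cDQ - k1 • cDA4 - dot cDk1 A4)
    (hIbar : Ibar = -cDk1 + (1 / 2 * yb) • Hbar - (1 / 2 * y) • (Hbar - Hbbar) - k1 • Hbbar) :
    n4F4 = cDQ + dot (Hbar + (2 : K) • Hbbar) Qt - k2 • (cDA4 + dot (Hbar + Hbbar) A4) + dot Ibar A4
      + (g₁ + dot (g₂ + g₃) A4) := by
  subst hcomm hA4 hk2 hLeib hIbar
  simp only [map_add, map_sub, map_neg, map_smul, LinearMap.add_apply, LinearMap.sub_apply,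
    LinearMap.neg_apply, LinearMap.smul_apply]
  module

/-- (D.7.8) = `[v1]` (eq:ov-mathcal-I): with `κ₁ = (5/2)tr X − conj tr X − 2w` and the conjugated
Lemma D.5.1, "`conj𝒟 tr X = −2i Im(tr X) H̄ + r⁻¹Γ_g`", "`conj𝒟 conj tr X = −2conj tr X H̲̄ + r⁻¹Γ_g`"
(hypotheses; `i Im(tr X) = ½(tr X − conj tr X)`, `him`):
`𝓘̄ = 4i Im(tr X)H̄ − (2tr X + conj tr X − 2w)H̲̄ + 2conj𝒟(w) + r⁻¹Γ_g`, as printed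
(`H̄`: `5i Im + ½(conj tr X − tr X) = 4i Im`).
[cite: GiorgiKlainermanSzeftel2024, (D.7.8) p0884 L126–140; GiorgiKlainermanSzeftel2022, l.36029–36039] -/
theorem D72_Ibar [CharZero K] (Dhb : Derivation ℤ K M₁) (i im y yb w k1 : K) (Hbar Hbbar g₁ g₂ : M₁)
    (hk1 : k1 = 5 / 2 * y - yb - 2 * w) (him : i * im = 1 / 2 * (y - yb))
    (hDy : Dhb y = -((2 * (i * im)) • Hbar) + g₁) (hDyb : Dhb yb = -((2 * yb) • Hbbar) + g₂) :
    -Dhb k1 + (1 / 2 * yb) • Hbar - (1 / 2 * y) • (Hbar - Hbbar) - k1 • Hbbar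
      = (4 * (i * im)) • Hbar - (2 * y + yb - 2 * w) • Hbbar + (2 : K) • Dhb w
        + (g₂ - (5 / 2 : K) • g₁) := by
  obtain ⟨h2, -, -, -, h52, -⟩ := Dv_num Dhb
  subst hk1
  rw [him] at hDy ⊢
  simp only [map_sub, Dhb.leibniz, hDy, hDyb, h2, h52, smul_zero, add_zero]
  module

/-- Step 1, `I := ¼(ᶜ∇₄𝒟⊗̂F4 + (2tr X + ½conj tr X)𝒟⊗̂F4)`.  Inputs: the `s = −1` commutator
"`[ᶜ∇₄, 𝒟⊗̂]F4 = H̲⊗̂ᶜ∇₄F4 − ½tr X(𝒟⊗̂F4 + 2H̲⊗̂F4) + l.o.t.`" (`hcomm`), (D.7.7) (`h77`), the Leibniz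
rule of `𝒟⊗̂` (`hDL`) and "`𝒟⊗̂(𝓘̄·A̲₄) = 2𝓘̄·𝒟A̲₄ + 2(𝒟·𝓘̄)A̲₄ + l.o.t.`" (`hDIA`).  Output, as
displayed: `I = ¼(𝒟 + H̲)⊗̂Gt − ¼μ 𝒟⊗̂F4 + ¼𝒥⊗̂F4 + ½𝓘̄·𝒟A̲₄ + ½(𝒟·𝓘̄)A̲₄ + ¼H̲⊗̂(𝓘̄·A̲₄) + l.o.t.`
with `𝒥 := −𝒟κ₂ − κ₂H̲ − tr X H̲` (the `𝒟⊗̂F4` coefficient is `−κ₂ − ½tr X + 2tr X + ½conj tr X = −μ`).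
[cite: GiorgiKlainermanSzeftel2024, p0883 L5–30, p0885 L1–140; GiorgiKlainermanSzeftel2022, l.35980–35988, l.36036–36063] -/
theorem D72_I [CharZero K] (hot : M₁ →ₗ[K] M₁ →ₗ[K] M₂) (Dhat : M₁ →+ M₂) (Dh : Derivation ℤ K M₁)
    (y yb w k2 : K) (F4 Gt IA G₁ Hb n4F4 : M₁) (n4DhF4 IdA dIA gI g₄ : M₂)
    (hDL : ∀ (f : K) (u : M₁), Dhat (f • u) = f • Dhat u + hot (Dh f) u)
    (hcomm : n4DhF4 = Dhat n4F4 + hot Hb n4F4 - (1 / 2 * y) • (Dhat F4 + (2 : K) • hot Hb F4) + g₄)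
    (h77 : n4F4 = Gt - k2 • F4 + IA + G₁) (hk2 : k2 = 5 / 2 * y - 1 / 2 * yb - 2 * w)
    (hDIA : Dhat IA = (2 : K) • IdA + (2 : K) • dIA + gI) :
    (1 / 4 : K) • (n4DhF4 + (2 * y + 1 / 2 * yb) • Dhat F4)
      = (1 / 4 : K) • (Dhat Gt + hot Hb Gt) - (1 / 4 * (y - yb - 2 * w)) • Dhat F4
        + (1 / 4 : K) • hot (-Dh k2 - k2 • Hb - y • Hb) F4
        + (1 / 2 : K) • IdA + (1 / 2 : K) • dIA + (1 / 4 : K) • hot Hb IA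
        + (1 / 4 : K) • (Dhat G₁ + hot Hb G₁ + gI + g₄) := by
  obtain ⟨h2, -, -, hhalf, h52, -⟩ := Dv_num Dh
  subst hcomm h77 hk2
  simp only [map_add, map_sub, map_neg, hDL, hDIA, map_smul, Dh.leibniz, h2, hhalf, h52, smul_zero,
    add_zero, LinearMap.sub_apply, LinearMap.neg_apply, LinearMap.smul_apply]
  module

/-- (D.7.9) = `[v1]` (eq:mathcal-J): with Lemma D.5.1, "`𝒟 tr X = −2tr X H̲ + r⁻¹Γ_g`",
"`𝒟 conj tr X = 2i Im(tr X)(H − Ȟ) + r⁻¹Γ_g`" (hypotheses) and `κ₂ = (5/2)tr X − ½conj tr X − 2w`: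
`𝒥 = −𝒟κ₂ − κ₂H̲ − tr X H̲ = i Im(tr X)(H − Ȟ) + 2𝒟(w) + ((3/2)tr X + ½conj tr X + 2w)H̲ + r⁻¹Γ_g`,
as printed.
[cite: GiorgiKlainermanSzeftel2024, (D.7.9) p0885 L141–p0886 L10; GiorgiKlainermanSzeftel2022, l.36060–36072] -/
theorem D72_calJ [CharZero K] (Dh : Derivation ℤ K M₁) (i im y yb w k2 : K) (H Hc Hb g₁ g₂ : M₁)
    (hk2 : k2 = 5 / 2 * y - 1 / 2 * yb - 2 * w)
    (hDy : Dh y = -((2 * y) • Hb) + g₁) (hDyb : Dh yb = (2 * (i * im)) • (H - Hc) + g₂) :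
    -Dh k2 - k2 • Hb - y • Hb
      = (i * im) • (H - Hc) + (2 : K) • Dh w + (3 / 2 * y + 1 / 2 * yb + 2 * w) • Hb
        + ((1 / 2 : K) • g₂ - (5 / 2 : K) • g₁) := by
  obtain ⟨h2, -, -, hhalf, h52, -⟩ := Dv_num Dh
  subst hk2
  simp only [map_sub, Dh.leibniz, hDy, hDyb, h2, h52, hhalf, smul_zero, add_zero]
  module

/-- (D.7.10) = `[v1]` (eq:mathcal-K), the one-form collecting `F4` in `J` (Step 2):
`𝒦 := −¼κ₂(H + 5H̲) + ¼ᶜ∇₄(H + 5H̲) + ¼(2tr X + ½conj tr X)(H + 5H̲)`; with "`ᶜ∇₄H =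
−½conj tr X(H − H̲) + r⁻¹Γ_g`", "`∇₄H̲ = −tr X H̲ + r⁻²Γ_g`":
`𝒦 = −¼[½(tr X − conj tr X − 4w)H + ((15/2)tr X − (11/2)conj tr X − 10w)H̲] + r⁻¹Γ_g`, as printed.
[cite: GiorgiKlainermanSzeftel2024, (D.7.10) p0886 L100–135; GiorgiKlainermanSzeftel2022, l.36075–36101] -/
theorem D72_calK [CharZero K] (y yb w k2 : K) (H Hb n4H n4Hb gH gHb : M₁)
    (hk2 : k2 = 5 / 2 * y - 1 / 2 * yb - 2 * w)
    (hn4H : n4H = -((1 / 2 * yb) • (H - Hb)) + gH) (hn4Hb : n4Hb = -(y • Hb) + gHb) :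
    -((1 / 4 * k2) • (H + (5 : K) • Hb)) + (1 / 4 : K) • (n4H + (5 : K) • n4Hb)
        + (1 / 4 * (2 * y + 1 / 2 * yb)) • (H + (5 : K) • Hb)
      = -((1 / 4 : K) • ((1 / 2 * (y - yb - 4 * w)) • H
          + (15 / 2 * y - 11 / 2 * yb - 10 * w) • Hb)) + (1 / 4 : K) • (gH + (5 : K) • gHb) := by
  subst hk2 hn4H hn4Hb
  module

/-- Step 2, `J := ¼(H + 5H̲)⊗̂ᶜ∇₄F4 + ¼ᶜ∇₄(H + 5H̲)⊗̂F4 + ¼(2tr X + ½conj tr X)(H + 5H̲)⊗̂F4`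
(product rule `hprod`), with (D.7.7) inserted: `J = ¼(H + 5H̲)⊗̂Gt + 𝒦⊗̂F4 + ¼(H + 5H̲)⊗̂(𝓘̄·A̲₄) + l.o.t.`
with `𝒦` the one-form of `D72_calK` (before evaluation).
[cite: GiorgiKlainermanSzeftel2024, p0886 L11–135; GiorgiKlainermanSzeftel2022, l.36075–36101] -/
theorem D72_J [CharZero K] (hot : M₁ →ₗ[K] M₁ →ₗ[K] M₂) (n4₁ : M₁ →+ M₁) (n4₂ : M₂ →+ M₂)
    (y yb k2 : K) (F4 Gt IA G₁ H Hb : M₁) (J : M₂)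
    (hprod : ∀ u v, n4₂ (hot u v) = hot (n4₁ u) v + hot u (n4₁ v))
    (hJ : J = (1 / 4 : K) • n4₂ (hot (H + (5 : K) • Hb) F4)
      + (1 / 4 * (2 * y + 1 / 2 * yb)) • hot (H + (5 : K) • Hb) F4)
    (h77 : n4₁ F4 = Gt - k2 • F4 + IA + G₁) :
    J = (1 / 4 : K) • hot (H + (5 : K) • Hb) Gt
      + hot (-((1 / 4 * k2) • (H + (5 : K) • Hb)) + (1 / 4 : K) • n4₁ (H + (5 : K) • Hb)
          + (1 / 4 * (2 * y + 1 / 2 * yb)) • (H + (5 : K) • Hb)) F4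
      + (1 / 4 : K) • hot (H + (5 : K) • Hb) IA + (1 / 4 : K) • hot (H + (5 : K) • Hb) G₁ := by
  subst hJ
  rw [hprod, h77]
  simp only [map_add, map_sub, map_neg, map_smul, LinearMap.add_apply, LinearMap.smul_apply,
    LinearMap.neg_apply]
  module

/-- Step 3, `K := 3ᶜ∇₄(PA̲₄) + 3(2tr X + ½conj tr X)PA̲₄` with "`ᶜ∇₄P = −(3/2)tr X P + s_P`"
(`s_P = ½𝒟·B̄ + H̲·B̄ − ¼X̲̂·Ā`, opaque) and `ᶜ∇₄A̲₄ = Q̃ − κ₁A̲₄`: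
"`K = 3PQ̃ − 3(2tr X − (3/2)conj tr X − 2w)PA̲₄ + l.o.t.`", as printed.
[cite: GiorgiKlainermanSzeftel2024, p0886 L149–p0887 L34; GiorgiKlainermanSzeftel2022, l.36104–36111] -/
theorem D72_K [CharZero K] (D : Derivation ℤ K K) (N4 : CovD D M₂) (y yb w k1 p sP : K) (A4 Qt : M₂)
    (hk1 : k1 = 5 / 2 * y - yb - 2 * w) (hDP : D p = -(3 / 2) * y * p + sP)
    (hA4 : N4.op A4 = Qt - k1 • A4) :
    (3 : K) • N4.op (p • A4) + (3 * (2 * y + 1 / 2 * yb) * p) • A4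
      = (3 * p) • Qt - (3 * (2 * y - 3 / 2 * yb - 2 * w) * p) • A4 + (3 * sP) • A4 := by
  subst hk1
  rw [N4.leibniz, hDP, hA4]
  module

/-- Step 4, `L := 3ᶜ∇₄((½conj tr X − tr X)PA̲) + 3(2tr X + ½conj tr X)(½conj tr X − tr X)PA̲`
with "`ᶜ∇₄tr X + ½(tr X)² = −½X̂·conj X̂`" and its conjugate (the quadratic scalars opaque),
"`ᶜ∇₄P = −(3/2)tr X P + s_P`", `ᶜ∇₄A̲ = A̲₄ − ½tr X A̲`:
"`L = 3(½conj tr X − tr X)PA̲₄ + (3/2)tr X(tr X − conj tr X)PA̲ + l.o.t.`", as printed; the kernel's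
remainder is `(3(½conj tr X − tr X)s_P + 3P(½X̂·conj X̂ − ¼conj(X̂·conj X̂)))A̲`.
[cite: GiorgiKlainermanSzeftel2024, p0887 L35–111; GiorgiKlainermanSzeftel2022, l.36113–36128] -/
theorem D72_L [CharZero K] (D : Derivation ℤ K K) (N4 : CovD D M₂) (y yb p sP XX XXb : K) (Ab A4 : M₂)
    (hDy : D y = -(1 / 2) * y ^ 2 - 1 / 2 * XX) (hDyb : D yb = -(1 / 2) * yb ^ 2 - 1 / 2 * XXb)
    (hDP : D p = -(3 / 2) * y * p + sP) (hA4 : N4.op Ab = A4 - (1 / 2 * y) • Ab) :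
    (3 : K) • N4.op (((1 / 2 * yb - y) * p) • Ab) + (3 * (2 * y + 1 / 2 * yb) * ((1 / 2 * yb - y) * p)) • Ab
      = (3 * (1 / 2 * yb - y) * p) • A4 + (3 / 2 * y * (y - yb) * p) • Ab
        + (3 * (1 / 2 * yb - y) * sP + 3 * p * (1 / 2 * XX - 1 / 4 * XXb)) • Ab := by
  obtain ⟨D2, -⟩ := D_num D
  rw [N4.leibniz, hA4]
  simp only [D.leibniz, map_sub, D.leibniz_div, hDy, hDyb, hDP, D2, D.map_one_eq_zero,
    smul_eq_mul, mul_zero, sub_zero, add_zero]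
  module

/-- Step 5, `M := ᶜ∇₄(𝒥₄₃₄⊗̂F) + (2tr X + ½conj tr X)𝒥₄₃₄⊗̂F` (product rule), with (D.7.5) in the
form `ᶜ∇₄F = F4 − ½(tr X + conj tr X)F + R` (`R = 2B̄·A̲ − ½X̂·conj𝒟A̲ − ½(𝒟·conj X̂)·A̲ + l.o.t.`):
"`M = 𝒥₄₃₄⊗̂F4 + (ᶜ∇₄𝒥₄₃₄ + (3/2)tr X 𝒥₄₃₄)⊗̂F + r⁻²𝔡(Γ_b·(A,B)) + …`" — coefficient
`2tr X + ½conj tr X − ½(tr X + conj tr X) = (3/2)tr X`, as printed; remainder `𝒥₄₃₄⊗̂R`.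
[cite: GiorgiKlainermanSzeftel2024, p0887 L112–p0888 L4; GiorgiKlainermanSzeftel2022, l.36131–36140] -/
theorem D72_M [CharZero K] (hot : M₁ →ₗ[K] M₁ →ₗ[K] M₂) (n4₁ : M₁ →+ M₁) (n4₂ : M₂ →+ M₂) (y yb : K)
    (F F4 R J434 : M₁) (hprod : ∀ u v, n4₂ (hot u v) = hot (n4₁ u) v + hot u (n4₁ v))
    (h75 : n4₁ F = F4 - (1 / 2 * (y + yb)) • F + R) :
    n4₂ (hot J434 F) + (2 * y + 1 / 2 * yb) • hot J434 F
      = hot J434 F4 + hot (n4₁ J434 + (3 / 2 * y) • J434) F + hot J434 R := by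
  rw [hprod, h75]
  simp only [map_add, map_sub, map_smul, LinearMap.add_apply, LinearMap.smul_apply]
  module

/-- Step 6, "We now combine Step 1 to Step 5" — the displayed sum (before the substitution), from
the five final forms (hypotheses `hI … hM`, schematic brackets `S_…`): `I + J + K + L + M =
¼(𝒟 + H + 6H̲)⊗̂Gt + 3PQ̃ − ¼μ𝒟⊗̂F4 + (¼𝒥 + 𝒦 + 𝒥₄₃₄)⊗̂F4 + ½𝓘̄·𝒟A̲₄ + ½(𝒟·𝓘̄)A̲₄ + ¼(H + 6H̲)⊗̂(𝓘̄·A̲₄)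
+ (−3tr X + 2conj tr X + 2w)3PA̲₄ + ½tr X(tr X − conj tr X)3PA̲ + (ᶜ∇₄𝒥₄₃₄ + (3/2)tr X 𝒥₄₃₄)⊗̂F + err̃₄₄₃₄`,
with the printed coefficients (`H̲⊗̂Gt`: `¼ + (5/4) = (6/4)`; `PA̲₄`: `−3(2tr X − (3/2)conj tr X − 2w)
+ 3(½conj tr X − tr X) = 3(−3tr X + 2conj tr X + 2w)`).
[cite: GiorgiKlainermanSzeftel2024, p0888 L5–p0889 L10; GiorgiKlainermanSzeftel2022, l.36143–36155] -/
theorem D72_step6_sum [CharZero K] (hot : M₁ →ₗ[K] M₁ →ₗ[K] M₂) (Dhat : M₁ →+ M₂) (y yb w p : K)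
    (F F4 Gt IA H Hb calJ calK J434 n4J434 : M₁) (I J Kt L M IdA dIA S_I S_J S_K S_L S_M A4 Ab Qt : M₂)
    (hI : I = (1 / 4 : K) • (Dhat Gt + hot Hb Gt) - (1 / 4 * (y - yb - 2 * w)) • Dhat F4
        + (1 / 4 : K) • hot calJ F4 + (1 / 2 : K) • IdA + (1 / 2 : K) • dIA + (1 / 4 : K) • hot Hb IA + S_I)
    (hJ : J = (1 / 4 : K) • hot (H + (5 : K) • Hb) Gt + hot calK F4
        + (1 / 4 : K) • hot (H + (5 : K) • Hb) IA + S_J)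
    (hK : Kt = (3 * p) • Qt - (3 * (2 * y - 3 / 2 * yb - 2 * w) * p) • A4 + S_K)
    (hL : L = (3 * (1 / 2 * yb - y) * p) • A4 + (3 / 2 * y * (y - yb) * p) • Ab + S_L)
    (hM : M = hot J434 F4 + hot (n4J434 + (3 / 2 * y) • J434) F + S_M) :
    I + J + Kt + L + M
      = (1 / 4 : K) • (Dhat Gt + hot (H + (6 : K) • Hb) Gt) + (3 * p) • Qt
        - (1 / 4 * (y - yb - 2 * w)) • Dhat F4
        + hot ((1 / 4 : K) • calJ + calK + J434) F4
        + (1 / 2 : K) • IdA + (1 / 2 : K) • dIA + (1 / 4 : K) • hot (H + (6 : K) • Hb) IA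
        + ((-3 * y + 2 * yb + 2 * w) * (3 * p)) • A4 + (1 / 2 * y * (y - yb) * (3 * p)) • Ab
        + hot (n4J434 + (3 / 2 * y) • J434) F
        + (S_I + S_J + S_K + S_L + S_M) := by
  subst hI hJ hK hL hM
  simp only [map_add, map_smul, LinearMap.add_apply, LinearMap.smul_apply]
  module

/-- Step 6, the substitution of `¼𝒟⊗̂F4` by (D.7.1) and the resulting shape of (D.7.6): with
`T = (ᶜ∇₄ + tr X + ½conj tr X)(ᶜ∇₃ + 2conj tr X̲ + ½tr X̲)A̲₄` given by (D.7.1) (`h71`, `err₄₃₄` explicit)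
and `LHS₂ = (ᶜ∇₄ + 2tr X + ½conj tr X)T` given by the Step-6 sum (`hsum`),
`LHS₂ + μT + (2tr X − conj tr X)3PA̲₄ = ¼(𝒟 + H + 6H̲)⊗̂Gt + 3PQ̃ + ℒ + (err̃₄₄₃₄ + μ err₄₃₄)`, where
`ℒ` is (D.7.11) = `[v1]` (eq:mathscr-L-Ab) literally: `(¼𝒥 + 𝒦 + 𝒥₄₃₄ + ¼μ(H + 5H̲))⊗̂F4 +
(ᶜ∇₄𝒥₄₃₄ + (3/2)tr X 𝒥₄₃₄ + μ𝒥₄₃₄)⊗̂F + (μ(½conj tr X − tr X) + ½tr X(tr X − conj tr X))3PA̲ +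
½𝓘̄·𝒟A̲₄ + ½(𝒟·𝓘̄)A̲₄ + ¼(H + 6H̲)⊗̂(𝓘̄·A̲₄)`.  On `err₄₃₄`: the kernel's total coefficient is the
`(2tr X + ½conj tr X)` of `err̃₄₄₃₄` plus `μ`, i.e. `3tr X − ½conj tr X − 2w`; the printed
`err₄₄₃₄ ∋ (tr X + (3/2)conj tr X + 2w)err₄₃₄ = (2tr X + ½conj tr X − μ)err₄₃₄` corresponds to the sign
with which the solved display quotes "`+err₄₃₄`" (schematic; see `D72_err434_coeff`).
[cite: GiorgiKlainermanSzeftel2024, (D.7.6) p0882 L54–80, (D.7.11) p0889 L11–66; GiorgiKlainermanSzeftel2022, l.35937–35963, l.36156–36185] -/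
theorem D72_substitution [CharZero K] (hot : M₁ →ₗ[K] M₁ →ₗ[K] M₂) (Dhat : M₁ →+ M₂) (y yb w p : K)
    (F F4 Gt IA H Hb calJ calK J434 n4J434 : M₁) (T LHS₂ IdA dIA err errt S A4 Ab Qt : M₂)
    (h71 : T = (1 / 4 : K) • Dhat F4 + (1 / 4 : K) • hot (H + (5 : K) • Hb) F4 + (3 * p) • A4
        + (3 * (1 / 2 * yb - y) * p) • Ab + hot J434 F + err)
    (hsum : LHS₂ = (1 / 4 : K) • (Dhat Gt + hot (H + (6 : K) • Hb) Gt) + (3 * p) • Qt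
        - (1 / 4 * (y - yb - 2 * w)) • Dhat F4
        + hot ((1 / 4 : K) • calJ + calK + J434) F4
        + (1 / 2 : K) • IdA + (1 / 2 : K) • dIA + (1 / 4 : K) • hot (H + (6 : K) • Hb) IA
        + ((-3 * y + 2 * yb + 2 * w) * (3 * p)) • A4 + (1 / 2 * y * (y - yb) * (3 * p)) • Ab
        + hot (n4J434 + (3 / 2 * y) • J434) F + (errt + S)) :
    LHS₂ + (y - yb - 2 * w) • T + ((2 * y - yb) * (3 * p)) • A4
      = (1 / 4 : K) • (Dhat Gt + hot (H + (6 : K) • Hb) Gt) + (3 * p) • Qt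
        + (hot ((1 / 4 : K) • calJ + calK + J434 + (1 / 4 * (y - yb - 2 * w)) • (H + (5 : K) • Hb)) F4
          + hot (n4J434 + (3 / 2 * y) • J434 + (y - yb - 2 * w) • J434) F
          + (((y - yb - 2 * w) * (1 / 2 * yb - y) + 1 / 2 * y * (y - yb)) * (3 * p)) • Ab
          + (1 / 2 : K) • IdA + (1 / 2 : K) • dIA + (1 / 4 : K) • hot (H + (6 : K) • Hb) IA)
        + (errt + (y - yb - 2 * w) • err + S) := by
  subst h71 hsum
  simp only [map_add, map_smul, LinearMap.add_apply, LinearMap.smul_apply]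
  module

/-- The three scalar coefficient facts of Step 6 (operator, `PA̲₄`, `err₄₃₄`):
`(2tr X + ½conj tr X) + μ = 3tr X − ½conj tr X − 2w` (the outer operator of (D.7.6));
`3(−3tr X + 2conj tr X + 2w) + 3μ = −(2tr X − conj tr X)·3` (the `PA̲₄` term moved left);
`(2tr X + ½conj tr X) − μ = tr X + (3/2)conj tr X + 2w` (the printed `err₄₃₄`-coefficient of `err₄₄₃₄`).
[cite: GiorgiKlainermanSzeftel2024, (D.7.6) p0882 L54–80, p0889 L1–20; GiorgiKlainermanSzeftel2022, l.35937–35950, l.36156–36174] -/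
theorem D72_err434_coeff [CharZero K] (y yb w : K) :
    (2 * y + 1 / 2 * yb) + (y - yb - 2 * w) = 3 * y - 1 / 2 * yb - 2 * w ∧
    3 * (-3 * y + 2 * yb + 2 * w) + 3 * (y - yb - 2 * w) = -((2 * y - yb) * 3) ∧
    (2 * y + 1 / 2 * yb) - (y - yb - 2 * w) = y + 3 / 2 * yb + 2 * w := by
  refine ⟨by ring, by ring, by ring⟩

/-- Step 7, "The term in `F4`": from (D.7.9), (D.7.10), (D.7.3) (hypotheses with remainders) and
`i Im(tr X) = ½(tr X − conj tr X)`,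
`¼𝒥 + 𝒦 + 𝒥₄₃₄ + ¼μ(H + 5H̲) = ¼[2𝒟(w) − 3tr X H̲ − μH̲ + (tr X − conj tr X)H] − ¼ i Im(tr X) Ȟ + l.o.t.`;
the bracket is as printed, the printed "`+Im(tr X)Ȟ`" is the kernel's `−¼ i Im(tr X)Ȟ` (schematic
coefficient).  Every explicit coefficient is `O(a)` except `−3tr X H̲ − μH̲ …` — not a kernel statement.
[cite: GiorgiKlainermanSzeftel2024, p0889 L67–p0890 L40; GiorgiKlainermanSzeftel2022, l.36187–36205] -/
theorem D72_step7_F4coeff [CharZero K] (i im y yb w : K) (H Hc Hb Dw calJ calK J434 gJ gK g434 : M₁)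
    (him : i * im = 1 / 2 * (y - yb))
    (hJ : calJ = (i * im) • (H - Hc) + (2 : K) • Dw + (3 / 2 * y + 1 / 2 * yb + 2 * w) • Hb + gJ)
    (hK : calK = -((1 / 4 : K) • ((1 / 2 * (y - yb - 4 * w)) • H
          + (15 / 2 * y - 11 / 2 * yb - 10 * w) • Hb)) + gK)
    (h434 : J434 = -((3 / 4 * y) • Hb) + g434) :
    (1 / 4 : K) • calJ + calK + J434 + (1 / 4 * (y - yb - 2 * w)) • (H + (5 : K) • Hb)
      = (1 / 4 : K) • ((2 : K) • Dw - (3 * y) • Hb - (y - yb - 2 * w) • Hb + (y - yb) • H)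
        - (1 / 4 * (i * im)) • Hc + ((1 / 4 : K) • gJ + gK + g434) := by
  rw [him] at hJ ⊢
  subst hJ hK h434
  module

/-- Step 7, `ᶜ∇₄𝒥₄₃₄` from (D.7.2) (`hJ`, with `S = 𝒟(tr X + conj tr X)` and remainder `Rj = r⁻²Γ_g
+ X̂·Ȟ`): inputs "`ᶜ∇₄H = −½conj tr X(H − H̲) + …`", "`∇₄H̲ = −tr X H̲ + …`", "`ᶜ∇₄tr X = −½(tr X)²`"
and conjugate (model values), and the displayed scalar commutator with `s = 1` as the text applies it,
"`[ᶜ∇₄, 𝒟]h = −½tr X 𝒟h + H̲ᶜ∇₄h − ½X̂·conj𝒟h + (½tr X H̲ − B)h + l.o.t.`", `h = tr X + conj tr X`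
(`hcomm`).  Output, as displayed ("which gives"): `ᶜ∇₄𝒥₄₃₄ = ¼[½tr X 𝒟tr X + ½conj tr X 𝒟conj tr X
+ ¼tr X S + (−¼(tr X)² − ¼conj tr X tr X + ½(conj tr X)²)H + 6(tr X)²H̲] − ¼ᶜ∇₄B + ⅛(tr X + conj tr X)B
+ (1/16)X̂·conj𝒟S + l.o.t.`; the two `O(a)` contributions to `H̲` (`(1/16)conj tr X(conj tr X − tr X)`
from the commutator, its negative from `⅛(tr X − conj tr X)ᶜ∇₄H`) cancel exactly, giving the printed `6`.
[cite: GiorgiKlainermanSzeftel2024, p0890 L41–p0891 L60; GiorgiKlainermanSzeftel2022, l.36207–36237] -/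
theorem D72_nab4_J434 [CharZero K] (D : Derivation ℤ K K) (n4 : CovD D M₁) (Dh : Derivation ℤ K M₁)
    (y yb : K) (J434 S H Hb B Rj XcDS gH gHb gc : M₁)
    (hJ : J434 = -((1 / 8 : K) • S) + (1 / 8 * (y - yb)) • H - y • Hb - (1 / 4 : K) • B + Rj)
    (hcomm : n4.op S = Dh (D y + D yb) - (1 / 2 * y) • S + (D y + D yb) • Hb - (1 / 2 : K) • XcDS
      + (y + yb) • ((1 / 2 * y) • Hb - B) + gc)
    (hDy : D y = -(1 / 2) * y ^ 2) (hDyb : D yb = -(1 / 2) * yb ^ 2)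
    (hn4H : n4.op H = -((1 / 2 * yb) • (H - Hb)) + gH) (hn4Hb : n4.op Hb = -(y • Hb) + gHb) :
    n4.op J434
      = (1 / 4 : K) • ((1 / 2 * y) • Dh y + (1 / 2 * yb) • Dh yb + (1 / 4 * y) • S
          + (-(1 / 4) * y ^ 2 - 1 / 4 * yb * y + 1 / 2 * yb ^ 2) • H + (6 * y ^ 2) • Hb)
        - (1 / 4 : K) • n4.op B + (1 / 8 * (y + yb)) • B + (1 / 16 : K) • XcDS
        + ((1 / 8 * (y - yb)) • gH - y • gHb - (1 / 8 : K) • gc + n4.op Rj) := by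
  obtain ⟨-, -, D4, -, D8⟩ := D_num D
  obtain ⟨-, -, -, hhalf, -⟩ := Dv_num Dh
  subst hJ
  simp only [map_add, map_sub, map_neg, n4.leibniz, hcomm, hn4H, hn4Hb, hDy, hDyb, D.leibniz,
    D.leibniz_div, D4, D8, D.map_one_eq_zero, pow_two, Dh.leibniz, hhalf, smul_eq_mul,
    mul_zero, sub_zero, add_zero, smul_zero, zero_smul, zero_add, neg_zero]
  module

/-- Step 7, "the term in `F`": from the previous display (`hN`, remainder `G_N`), (D.7.2) (`hJ`) and
`S = 𝒟tr X + 𝒟conj tr X` (`hS`):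
`ᶜ∇₄𝒥₄₃₄ + (3/2)tr X 𝒥₄₃₄ + μ𝒥₄₃₄ = ¼[½(conj tr X − tr X)𝒟conj tr X + (½(tr X)² − conj tr X tr X +
½(conj tr X)²)H] + μ𝒥₄₃₄ + (B-terms) + (1/16)X̂·conj𝒟S + (3/2)tr X Rj + G_N`, as printed
(`H̲`: `(6/4)(tr X)² − (3/2)(tr X)² = 0`); the `B`-terms `−¼ᶜ∇₄B + (⅛(tr X + conj tr X) − ⅜tr X)B` are
the text's `r⁻¹𝔡B`.  The scalar `½(tr X)² − conj tr X tr X + ½(conj tr X)² = −2⁽ᵃ⁾tr χ²` is `half_sq_diff`.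
[cite: GiorgiKlainermanSzeftel2024, p0891 L61–90; GiorgiKlainermanSzeftel2022, l.36238–36249] -/
theorem D72_Fcoeff [CharZero K] (Dh : Derivation ℤ K M₁) (y yb w : K)
    (J434 n4J434 S H Hb B n4B Rj XcDS G_N : M₁) (hS : S = Dh y + Dh yb)
    (hJ : J434 = -((1 / 8 : K) • S) + (1 / 8 * (y - yb)) • H - y • Hb - (1 / 4 : K) • B + Rj)
    (hN : n4J434 = (1 / 4 : K) • ((1 / 2 * y) • Dh y + (1 / 2 * yb) • Dh yb + (1 / 4 * y) • S
          + (-(1 / 4) * y ^ 2 - 1 / 4 * yb * y + 1 / 2 * yb ^ 2) • H + (6 * y ^ 2) • Hb)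
        - (1 / 4 : K) • n4B + (1 / 8 * (y + yb)) • B + (1 / 16 : K) • XcDS + G_N) :
    n4J434 + (3 / 2 * y) • J434 + (y - yb - 2 * w) • J434
      = (1 / 4 : K) • ((1 / 2 * (yb - y)) • Dh yb + (1 / 2 * y ^ 2 - yb * y + 1 / 2 * yb ^ 2) • H)
        + (y - yb - 2 * w) • J434
        + (-((1 / 4 : K) • n4B) + (1 / 8 * (y + yb) - 3 / 8 * y) • B)
        + (1 / 16 : K) • XcDS + ((3 / 2 * y) • Rj + G_N) := by
  subst hN hS
  rw [hJ]
  module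

end PropD72

/-! ## §C The coefficient `W̲₃`: "`Z̲₃ = O(a² r⁻⁵)`"

`[J]` p0892 L6–43 = `[v1]` l.36266–36282: "The coefficient comes from the symmetric of `W₄` …, whose
lowest decaying term is given by `Z₄` in Proposition D.4.1, i.e.
`Z̲₃ = ᶜ∇₄C̲̃₂ + 2 tr χ C̲̃₂ − ¼(tr χ² + ⁽ᵃ⁾tr χ²)C̲̃₁`", where by (5.3.3) `C̲₁ = 2 tr χ + C̲̃₁`,
`C̲₂ = ½ tr χ² + C̲̃₂`, i.e. `C̲̃₁ = −2⁽ᵃ⁾tr χ²/tr χ − 4i ⁽ᵃ⁾tr χ`,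
`C̲̃₂ = −4⁽ᵃ⁾tr χ² + (3/2)⁽ᵃ⁾tr χ⁴/tr χ² + i(−2 tr χ ⁽ᵃ⁾tr χ + 4⁽ᵃ⁾tr χ³/tr χ)` (the sibling's `C1`, `C2`
BY NAME).  Model: `ᶜ∇₄` acts on functions of `(tr χ, ⁽ᵃ⁾tr χ)` through a derivation `D` with the
Kerr transport values `D tr χ = −½(tr χ² − ⁽ᵃ⁾tr χ²)`, `D ⁽ᵃ⁾tr χ = −tr χ ⁽ᵃ⁾tr χ` (`[v1]` l.4605–4606
with `χ̂ = ξ = 0`; these are the values `e4_trch_out`, `e4_atrch_out` of the sibling certify on the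
printed outgoing tables, see `Zb3_leading_kerr_out`).  The text evaluates only the `O(a)` parts
`C̲̃₂ ↦ −2i tr χ ⁽ᵃ⁾tr χ`, `C̲̃₁ ↦ −4i ⁽ᵃ⁾tr χ` and uses the truncated transport `ᶜ∇₄ tr χ = −½ tr χ²`. -/

/-- The displayed arithmetic, literally: "`−2i(−½ tr χ² ⁽ᵃ⁾tr χ + tr χ(−tr χ ⁽ᵃ⁾tr χ)) + 2 tr χ(−2i tr χ ⁽ᵃ⁾tr χ)
+ i tr χ² ⁽ᵃ⁾tr χ`" sums to `0` (the three `tr χ² ⁽ᵃ⁾tr χ` coefficients are `3i − 4i + i`).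
[cite: GiorgiKlainermanSzeftel2024, p0892 L25–43; GiorgiKlainermanSzeftel2022, l.36276–36280] -/
theorem Zb3_display [CharZero K] (i t ta : K) :
    -2 * i * (-(1 / 2) * t ^ 2 * ta + t * (-(t * ta))) + 2 * t * (-2 * i * t * ta) + i * t ^ 2 * ta = 0 := by
  ring

/-- The `O(a)` part of `Z̲₃` with the TRUNCATED transport used in the display (`D tr χ = −½ tr χ²`,
`D ⁽ᵃ⁾tr χ = −tr χ ⁽ᵃ⁾tr χ`): `D(−2i tr χ ⁽ᵃ⁾tr χ) + 2 tr χ(−2i tr χ ⁽ᵃ⁾tr χ) − ¼(tr χ² + ⁽ᵃ⁾tr χ²)(−4i ⁽ᵃ⁾tr χ)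
= i ⁽ᵃ⁾tr χ³` — the `tr χ² ⁽ᵃ⁾tr χ` terms cancel and the cubic remainder is the `O(a³r⁻⁶) ⊂ O(a²r⁻⁵)`
the text drops.
[cite: GiorgiKlainermanSzeftel2024, p0892 L19–43; GiorgiKlainermanSzeftel2022, l.36274–36281] -/
theorem Zb3_leading_truncated [CharZero K] (D : Derivation ℤ K K) (i t ta : K) (hDi : D i = 0)
    (hDt : D t = -(1 / 2) * t ^ 2) (hDat : D ta = -(t * ta)) :
    D (-2 * i * t * ta) + 2 * t * (-2 * i * t * ta) - 1 / 4 * (t ^ 2 + ta ^ 2) * (-4 * i * ta)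
      = i * ta ^ 3 := by
  obtain ⟨D2, -⟩ := D_num D
  simp only [D.leibniz, hDi, hDt, hDat, D2, map_neg, smul_eq_mul, mul_zero, add_zero, neg_zero,
    mul_neg]
  ring

/-- The same `O(a)` part with the full Kerr transport `D tr χ = −½(tr χ² − ⁽ᵃ⁾tr χ²)`,
`D ⁽ᵃ⁾tr χ = −tr χ ⁽ᵃ⁾tr χ`: it vanishes identically (the extra `½⁽ᵃ⁾tr χ²` produces `−i⁽ᵃ⁾tr χ³`,
cancelling the cubic remainder of `Zb3_leading_truncated`).
[cite: GiorgiKlainermanSzeftel2024, p0892 L6–43; GiorgiKlainermanSzeftel2022, l.36266–36282, l.4605–4606] -/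
theorem Zb3_leading [CharZero K] (D : Derivation ℤ K K) (i t ta : K) (hDi : D i = 0)
    (hDt : D t = -(1 / 2) * (t ^ 2 - ta ^ 2)) (hDat : D ta = -(t * ta)) :
    D (-2 * i * t * ta) + 2 * t * (-2 * i * t * ta) - 1 / 4 * (t ^ 2 + ta ^ 2) * (-4 * i * ta) = 0 := by
  obtain ⟨D2, -⟩ := D_num D
  simp only [D.leibniz, hDi, hDt, hDat, D2, map_neg, smul_eq_mul, mul_zero, add_zero, neg_zero,
    mul_neg]
  ring

/-- The hypotheses of `Zb3_leading` are realised by the printed Kerr tables: on the outgoing values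
`tr χ = 2r/|q|²`, `⁽ᵃ⁾tr χ = 2a cos θ/|q|²` of the sibling module with `e₄ = ∂ᵣ` (`e4_trch_out`,
`e4_atrch_out` BY NAME) the `O(a)` part of `Z̲₃` vanishes.
[cite: GiorgiKlainermanSzeftel2024, p0892 L6–43, §3.3.2 p0127 L130–140; GiorgiKlainermanSzeftel2022, l.36266–36282, l.5735–5740] -/
theorem Zb3_leading_kerr_out [CharZero K] (D : Derivation ℤ K K) (i r a c : K) (hN : nsq r a c ≠ 0) (hDr : D r = 1)
    (hDa : D a = 0) (hDc : D c = 0) (hDi : D i = 0) :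
    D (-2 * i * trchO r a c * atrchO r a c) + 2 * trchO r a c * (-2 * i * trchO r a c * atrchO r a c)
      - 1 / 4 * (trchO r a c ^ 2 + atrchO r a c ^ 2) * (-4 * i * atrchO r a c) = 0 :=
  Zb3_leading D i (trchO r a c) (atrchO r a c) hDi (e4_trch_out D r a c hN hDr hDa hDc)
    (e4_atrch_out D r a c hN hDr hDa hDc)

/-- The whole `Z̲₃` in the same model, with the complete `C̲̃₁ = C̲₁ − 2 tr χ`, `C̲̃₂ = C̲₂ − ½ tr χ²`
(`C1`, `C2` of the sibling, evaluated on `(tr χ, ⁽ᵃ⁾tr χ)`): every surviving term carries `⁽ᵃ⁾tr χ²`,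
`Z̲₃ = ½ tr χ ⁽ᵃ⁾tr χ² − ⁽ᵃ⁾tr χ⁴/tr χ − (3/2)⁽ᵃ⁾tr χ⁶/tr χ³ − 2i(⁽ᵃ⁾tr χ³ + ⁽ᵃ⁾tr χ⁵/tr χ²)`, consistent
with the stated `Z̲₃ = O(a² r⁻⁵)` (`tr χ = O(r⁻¹)`, `⁽ᵃ⁾tr χ = O(a r⁻²)`; the order itself is not a
kernel statement).
[cite: GiorgiKlainermanSzeftel2024, p0892 L6–43, (5.3.3) p0199; GiorgiKlainermanSzeftel2022, l.36266–36282, l.9101–9106] -/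
theorem Zb3_exact [CharZero K] (D : Derivation ℤ K K) (i t ta : K) (ht : t ≠ 0) (hDi : D i = 0)
    (hDt : D t = -(1 / 2) * (t ^ 2 - ta ^ 2)) (hDat : D ta = -(t * ta)) :
    D (C2 i t ta - 1 / 2 * t ^ 2) + 2 * t * (C2 i t ta - 1 / 2 * t ^ 2)
        - 1 / 4 * (t ^ 2 + ta ^ 2) * (C1 i t ta - 2 * t)
      = 1 / 2 * t * ta ^ 2 - ta ^ 4 / t - 3 / 2 * (ta ^ 6 / t ^ 3)
        - 2 * i * (ta ^ 3 + ta ^ 5 / t ^ 2) := by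
  obtain ⟨D2, D3, D4, -⟩ := D_num D
  unfold C1 C2
  simp only [map_add, map_sub, map_neg, D.leibniz, D.leibniz_pow, D.leibniz_div, hDi, hDt,
    hDat, D2, D3, D4, smul_eq_mul, nsmul_eq_mul, Nat.cast_ofNat, mul_zero, add_zero,
    sub_zero, mul_neg, neg_mul]
  field_simp
  ring

/-! ## §D `[J]` Proposition D.7.3 = `[v1]` Proposition D.6.3 (`prop:appendix-error-terms-qfb`) -/

section PropD73

variable {M₁ M₂ : Type*} [AddCommGroup M₁] [Module K M₁] [AddCommGroup M₂] [Module K M₂]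

/-- The per-term computations of this proposition are insensitive to the numerical coefficient a
term carries in `err_TE`: for a constant `λ` (`D λ = 0`), `ᶜ∇₄(λT) + α(λT) = λ(ᶜ∇₄T + αT)`.  Hence
they apply verbatim to both coefficient lists of the sibling `TeukolskyAbarLedger`
(`errTE_printed_chain`: `−2, −½, −3/2, 1, 1, −3`; `errTE_derived`: `1, −1, −¼, ½, ½, −3/2, −3`); the
two STRUCTURAL differences — the extra `B̲⊗̂B̲` of `errTE_derived` and the `Ȟ`-coefficient of
(D.5.3b) entering `ᶜ∇₄Ξ̲` — are treated below (`D73_BB_first`, `D73_BB_second`, `D73_S1_residues`).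
[cite: GiorgiKlainermanSzeftel2024, p0893 L78–82; GiorgiKlainermanSzeftel2022, l.36332–36340] -/
theorem D73_coefficient_free (D : Derivation ℤ K K) (N4 : CovD D M₂) (lam α : K) (T : M₂)
    (hlam : D lam = 0) : N4.op (lam • T) + α • (lam • T) = lam • (N4.op T + α • T) := by
  rw [N4.leibniz, hlam]
  module

/-- Step 1, `I₁ := ᶜ∇₄(tr X Ξ̲⊗̂B̲) + (½tr X + conj tr X)(tr X Ξ̲⊗̂B̲)` — the displayed regrouping,
EXACT: `I₁ = (ᶜ∇₄tr X + ½(tr X)²)Ξ̲⊗̂B̲ + tr X ᶜ∇₄Ξ̲⊗̂B̲ + tr X Ξ̲⊗̂(ᶜ∇₄B̲ + tr X B̲) + (conj tr X − tr X)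
(tr X Ξ̲⊗̂B̲)` (scalar Leibniz of `ᶜ∇₄` on 2-tensors and the product rule of `⊗̂`, `hprod`).
[cite: GiorgiKlainermanSzeftel2024, p0893 L83–110; GiorgiKlainermanSzeftel2022, l.36341–36349] -/
theorem D73_I1_regroup [CharZero K] (hot : M₁ →ₗ[K] M₁ →ₗ[K] M₂) (D : Derivation ℤ K K) (n4 : M₁ →+ M₁)
    (N4 : CovD D M₂) (y yb : K) (Xib Bb : M₁)
    (hprod : ∀ u v, N4.op (hot u v) = hot (n4 u) v + hot u (n4 v)) :
    N4.op (y • hot Xib Bb) + (1 / 2 * y + yb) • (y • hot Xib Bb)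
      = (D y + 1 / 2 * y ^ 2) • hot Xib Bb + y • hot (n4 Xib) Bb + y • hot Xib (n4 Bb + y • Bb)
        + ((yb - y) * y) • hot Xib Bb := by
  rw [N4.leibniz, hprod]
  simp only [map_add, map_smul]
  module

/-- Step 1, `I₁` after inserting "`ᶜ∇₄Ξ̲ = c Ȟ − B̲ − ½X̲̂·Ȟ + r⁻²Γ_b`" and "`ᶜ∇₄B̲ + tr X B̲ = r⁻²Γ_g`",
"`ᶜ∇₄tr X + ½(tr X)² = g_y`" (hypotheses with remainders): `I₁ = tr X(cȞ − B̲ − ½X̲̂·Ȟ)⊗̂B̲ + (remainders)`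
— the display with `c = −½conj tr X` as printed in (D.5.3b); the kernel keeps `c` GENERIC because the
sibling's `D53b_symbolic` derives `c = −½conj(tr X̲)` from the quoted equation.  The remainder bracket
contains the `O(a)` term `(conj tr X − tr X)tr X Ξ̲⊗̂B̲`.  The text's schematic summary
"`I₁ = (tr X)²Ȟ⊗̂B̲ + tr X(B̲⊗̂B̲) + tr X(X̲̂·Ȟ)⊗̂B̲ + …`" drops the coefficients `c/tr X, −1, −½`.
[cite: GiorgiKlainermanSzeftel2024, p0893 L83–p0894 L40; GiorgiKlainermanSzeftel2022, l.36341–36357] -/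
theorem D73_I1 [CharZero K] (hot : M₁ →ₗ[K] M₁ →ₗ[K] M₂) (D : Derivation ℤ K K) (n4 : M₁ →+ M₁)
    (N4 : CovD D M₂) (y yb c gy : K) (Xib Bb Hc XbhHc gXi gB : M₁)
    (hprod : ∀ u v, N4.op (hot u v) = hot (n4 u) v + hot u (n4 v))
    (hXi : n4 Xib = c • Hc - Bb - (1 / 2 : K) • XbhHc + gXi) (hB : n4 Bb = -(y • Bb) + gB)
    (hDy : D y = -(1 / 2) * y ^ 2 + gy) :
    N4.op (y • hot Xib Bb) + (1 / 2 * y + yb) • (y • hot Xib Bb)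
      = (y * c) • hot Hc Bb - y • hot Bb Bb - (1 / 2 * y) • hot XbhHc Bb
        + (gy • hot Xib Bb + y • hot gXi Bb + y • hot Xib gB + ((yb - y) * y) • hot Xib Bb) := by
  rw [N4.leibniz, hprod, hXi, hB, hDy]
  simp only [map_add, map_sub, map_neg, map_smul, LinearMap.add_apply, LinearMap.sub_apply,
    LinearMap.smul_apply]
  module

/-- Steps 1a/3 pattern, EXACT for a generic scalar `φ` and one-forms `u, v`:
`ᶜ∇₄(φ u⊗̂v) + (tr X + (3/2)conj tr X)(φ u⊗̂v) = (ᶜ∇₄φ + conj tr X φ)u⊗̂v + φ(ᶜ∇₄u + ½conj tr X u)⊗̂v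
+ φ u⊗̂(ᶜ∇₄v + tr X v)` (`conj tr X + ½conj tr X + tr X = tr X + (3/2)conj tr X`).  With `u = Ȟ`,
`v = B̲` this is the `S₁`-regrouping whose last two brackets are the quoted `r⁻²Γ_g`'s
((equation:nabc_4Hc) and `[v1]` Proposition `prop:preliminaries-qfb-bianchi-lin`, as cited there); what decides `S₁` is the scalar `ᶜ∇₄φ + conj tr X φ`
(`D73_S1_residues`).
[cite: GiorgiKlainermanSzeftel2024, p0894 L70–100; GiorgiKlainermanSzeftel2022, l.36370–36384] -/
theorem D73_S_generic [CharZero K] (hot : M₁ →ₗ[K] M₁ →ₗ[K] M₂) (D : Derivation ℤ K K) (n4 : M₁ →+ M₁)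
    (N4 : CovD D M₂) (y yb φ : K) (u v : M₁)
    (hprod : ∀ u v, N4.op (hot u v) = hot (n4 u) v + hot u (n4 v)) :
    N4.op (φ • hot u v) + ((y + 3 / 2 * yb) * φ) • hot u v
      = (D φ + yb * φ) • hot u v + φ • hot (n4 u + (1 / 2 * yb) • u) v + φ • hot u (n4 v + y • v) := by
  rw [N4.leibniz, hprod]
  simp only [map_add, map_smul, LinearMap.add_apply, LinearMap.smul_apply]
  module

/-- Step 1a as displayed (`φ = (tr X)²`): `S₁ = (ᶜ∇₄(tr X)² + (tr X)³)Ȟ⊗̂B̲ + (tr X)²(ᶜ∇₄Ȟ + ½conj tr X Ȟ)⊗̂B̲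
+ (tr X)²Ȟ⊗̂(ᶜ∇₄B̲ + tr X B̲) + [(conj tr X − tr X)(tr X)²Ȟ⊗̂B̲]` — EXACT with the bracketed `O(a)` term,
which the display leaves inside `r⁻⁴𝔡^{≤3}(Γ_g·Γ_b)`.
[cite: GiorgiKlainermanSzeftel2024, p0894 L70–100; GiorgiKlainermanSzeftel2022, l.36370–36384] -/
theorem D73_S1_text [CharZero K] (hot : M₁ →ₗ[K] M₁ →ₗ[K] M₂) (D : Derivation ℤ K K) (n4 : M₁ →+ M₁)
    (N4 : CovD D M₂) (y yb : K) (Hc Bb : M₁)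
    (hprod : ∀ u v, N4.op (hot u v) = hot (n4 u) v + hot u (n4 v)) :
    N4.op (y ^ 2 • hot Hc Bb) + ((y + 3 / 2 * yb) * y ^ 2) • hot Hc Bb
      = (D (y ^ 2) + y ^ 3) • hot Hc Bb + y ^ 2 • hot (n4 Hc + (1 / 2 * yb) • Hc) Bb
        + y ^ 2 • hot Hc (n4 Bb + y • Bb) + ((yb - y) * y ^ 2) • hot Hc Bb := by
  rw [N4.leibniz, hprod]
  simp only [map_add, map_smul, LinearMap.add_apply, LinearMap.smul_apply]
  module

/-- The scalar deciding `S₁`, `ᶜ∇₄φ + conj tr X φ`, under "`ᶜ∇₄tr X = −½(tr X)² + g_y`",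
"`ᶜ∇₄conj tr X = −½(conj tr X)² + g_yb`": (a) the displayed `ᶜ∇₄(tr X)² + (tr X)³ = 2tr X g_y`;
(b) `φ = (tr X)²` (the text's schematic coefficient): `(conj tr X − tr X)(tr X)² + 2tr X g_y`;
(c) `φ = −½tr X conj tr X` (the exact coefficient `tr X · c` with the PRINTED `c = −½conj tr X`):
`¼tr X conj tr X(tr X − conj tr X) − ½(conj tr X g_y + tr X g_yb)`;
(d) `φ = −½tr X conj(tr X̲)` (with the sibling's DERIVED `c = −½conj tr X̲`; `ᶜ∇₄conj tr X̲ =: d` opaque,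
no transport equation for it is quoted in D.7): `−½tr X(d + ½conj tr X conj tr X̲) + ¼tr X(tr X −
conj tr X)conj tr X̲ − ½g_y conj tr X̲`.  In (b), (c) the explicit part carries the factor
`tr X − conj tr X = −2i⁽ᵃ⁾tr χ`; in (d) it is the combination `ᶜ∇₄conj tr X̲ + ½conj tr X conj tr X̲`
that would have to be small.  No verdict is a kernel statement.
[cite: GiorgiKlainermanSzeftel2024, p0894 L70–100, (D.5.3b) p0866 L124–143; GiorgiKlainermanSzeftel2022, l.36370–36384, l.35366–35369] -/
theorem D73_S1_residues [CharZero K] (D : Derivation ℤ K K) (y yb xb gy gyb d : K)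
    (hDy : D y = -(1 / 2) * y ^ 2 + gy) (hDyb : D yb = -(1 / 2) * yb ^ 2 + gyb) (hDxb : D xb = d) :
    D (y ^ 2) + y ^ 3 = 2 * y * gy ∧
    D (y ^ 2) + yb * y ^ 2 = (yb - y) * y ^ 2 + 2 * y * gy ∧
    D (-(1 / 2) * y * yb) + yb * (-(1 / 2) * y * yb)
      = 1 / 4 * y * yb * (y - yb) - 1 / 2 * (yb * gy + y * gyb) ∧
    D (-(1 / 2) * y * xb) + yb * (-(1 / 2) * y * xb)
      = -(1 / 2) * y * (d + 1 / 2 * yb * xb) + 1 / 4 * y * (y - yb) * xb - 1 / 2 * gy * xb := by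
  obtain ⟨D2, -⟩ := D_num D
  simp only [pow_two, D.leibniz, map_neg, D.leibniz_div, hDy, hDyb, hDxb, D2, D.map_one_eq_zero,
    smul_eq_mul, mul_zero, sub_zero, neg_zero, add_zero]
  refine ⟨by ring, by ring, by ring, by ring⟩

/-- Step 1b, EXACT (`⊗̂` symmetric, `hsym`): `S₂ = ᶜ∇₄(tr X B̲⊗̂B̲) + (tr X + (3/2)conj tr X)tr X B̲⊗̂B̲
= (ᶜ∇₄tr X + ½(tr X)²)B̲⊗̂B̲ + 2tr X(ᶜ∇₄B̲ + tr X B̲)⊗̂B̲ + [(3/2)tr X(conj tr X − tr X)B̲⊗̂B̲]` — the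
display plus the bracketed `O(a)` term.
[cite: GiorgiKlainermanSzeftel2024, p0894 L101–p0895 L5; GiorgiKlainermanSzeftel2022, l.36386–36392] -/
theorem D73_S2 [CharZero K] (hot : M₁ →ₗ[K] M₁ →ₗ[K] M₂) (D : Derivation ℤ K K) (n4 : M₁ →+ M₁)
    (N4 : CovD D M₂) (y yb : K) (Bb : M₁)
    (hprod : ∀ u v, N4.op (hot u v) = hot (n4 u) v + hot u (n4 v)) (hsym : ∀ u v, hot u v = hot v u) :
    N4.op (y • hot Bb Bb) + ((y + 3 / 2 * yb) * y) • hot Bb Bb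
      = (D y + 1 / 2 * y ^ 2) • hot Bb Bb + (2 * y) • hot (n4 Bb + y • Bb) Bb
        + (3 / 2 * y * (yb - y)) • hot Bb Bb := by
  rw [N4.leibniz, hprod, hsym Bb (n4 Bb)]
  simp only [map_add, map_smul, LinearMap.add_apply, LinearMap.smul_apply]
  module

/-- Step 1c, EXACT: with `U = X̲̂·Ȟ` and the Leibniz expansion "`ᶜ∇₄(X̲̂·Ȟ) = (ᶜ∇₄X̲̂ + ½tr X X̲̂)·Ȟ +
X̲̂·(ᶜ∇₄Ȟ + ½conj tr X Ȟ) − ½(tr X + conj tr X)(X̲̂·Ȟ) + l.o.t.`" (`hU`, the two brackets opaque):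
`S₃ = (ᶜ∇₄tr X + ½(tr X)²)U⊗̂B̲ + tr X T₁⊗̂B̲ + tr X T₂⊗̂B̲ + tr X U⊗̂(ᶜ∇₄B̲ + tr X B̲) + [tr X(conj tr X −
tr X)U⊗̂B̲] + l.o.t.` — with the bracket `(ᶜ∇₄B̲ + tr X B̲)` (the quoted `r⁻²Γ_g`).  Both texts print the
last bracket as `(ᶜ∇₄B̲ + 2tr X B̲)`; see `D73_S3_printed_bracket`.
[cite: GiorgiKlainermanSzeftel2024, p0895 L6–58; GiorgiKlainermanSzeftel2022, l.36394–36406] -/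
theorem D73_S3 [CharZero K] (hot : M₁ →ₗ[K] M₁ →ₗ[K] M₂) (D : Derivation ℤ K K) (n4 : M₁ →+ M₁)
    (N4 : CovD D M₂) (y yb : K) (U T₁ T₂ gU Bb : M₁)
    (hprod : ∀ u v, N4.op (hot u v) = hot (n4 u) v + hot u (n4 v))
    (hU : n4 U = T₁ + T₂ - (1 / 2 * y + 1 / 2 * yb) • U + gU) :
    N4.op (y • hot U Bb) + ((y + 3 / 2 * yb) * y) • hot U Bb
      = (D y + 1 / 2 * y ^ 2) • hot U Bb + y • hot T₁ Bb + y • hot T₂ Bb + y • hot U (n4 Bb + y • Bb)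
        + (y * (yb - y)) • hot U Bb + y • hot gU Bb := by
  rw [N4.leibniz, hprod, hU]
  simp only [map_add, map_sub, map_smul, LinearMap.add_apply, LinearMap.sub_apply,
    LinearMap.smul_apply]
  module

/-- Step 1c with the PRINTED last bracket `(ᶜ∇₄B̲ + 2tr X B̲)`: the same exact identity then leaves
`tr X(conj tr X − 2tr X)U⊗̂B̲ = [tr X(conj tr X − tr X) − (tr X)²]U⊗̂B̲`, which is not `O(a)`; the
bracket that is `r⁻²Γ_g` (and is used in Steps 1, 1a, 1b, 2, 3 of the same proof) is `ᶜ∇₄B̲ + tr X B̲`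
— the printed "`2tr X`" reads "`tr X`".  Print-level; the stated conclusion `S₃ = r⁻⁴𝔡^{≤3}(Γ_g·Γ_b)`
refers to the corrected bracket.
[cite: GiorgiKlainermanSzeftel2024, p0895 L43; GiorgiKlainermanSzeftel2022, l.36398] -/
theorem D73_S3_printed_bracket [CharZero K] (hot : M₁ →ₗ[K] M₁ →ₗ[K] M₂) (D : Derivation ℤ K K)
    (n4 : M₁ →+ M₁) (N4 : CovD D M₂) (y yb : K) (U T₁ T₂ gU Bb : M₁)
    (hprod : ∀ u v, N4.op (hot u v) = hot (n4 u) v + hot u (n4 v))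
    (hU : n4 U = T₁ + T₂ - (1 / 2 * y + 1 / 2 * yb) • U + gU) :
    N4.op (y • hot U Bb) + ((y + 3 / 2 * yb) * y) • hot U Bb
      = (D y + 1 / 2 * y ^ 2) • hot U Bb + y • hot T₁ Bb + y • hot T₂ Bb
        + y • hot U (n4 Bb + (2 * y) • Bb)
        + (y * (yb - y) - y ^ 2) • hot U Bb + y • hot gU Bb := by
  rw [D73_S3 hot D n4 N4 y yb U T₁ T₂ gU Bb hprod hU]
  simp only [map_add, map_smul]
  module

/-- The extra term `B̲⊗̂B̲` of the sibling's `errTE_derived` (coefficient `1`; absent from the printed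
`err_TE`), first operator of (D.7.4): `ᶜ∇₄(B̲⊗̂B̲) + (½tr X + conj tr X)B̲⊗̂B̲ = 2(ᶜ∇₄B̲ + tr X B̲)⊗̂B̲ +
(conj tr X − (3/2)tr X)B̲⊗̂B̲` (EXACT, `⊗̂` symmetric) — an `r⁻²Γ_g·B̲` bracket plus a `B̲⊗̂B̲` term whose
coefficient `φ₂ = conj tr X − (3/2)tr X` is NOT small; its fate is decided by the second operator
(`D73_BB_second`, `D73_BB_residue`).
[cite: GiorgiKlainermanSzeftel2024, (D.7.4) p0877 L16–40, p0894 L101–p0895 L5; GiorgiKlainermanSzeftel2022, l.35738–35747, l.36386–36392] -/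
theorem D73_BB_first [CharZero K] (hot : M₁ →ₗ[K] M₁ →ₗ[K] M₂) (n4 : M₁ →+ M₁) (N4 : M₂ →+ M₂)
    (y yb : K) (Bb : M₁) (hprod : ∀ u v, N4 (hot u v) = hot (n4 u) v + hot u (n4 v))
    (hsym : ∀ u v, hot u v = hot v u) :
    N4 (hot Bb Bb) + (1 / 2 * y + yb) • hot Bb Bb
      = (2 : K) • hot (n4 Bb + y • Bb) Bb + (yb - 3 / 2 * y) • hot Bb Bb := by
  rw [hprod, hsym Bb (n4 Bb)]
  simp only [map_add, map_smul, LinearMap.add_apply, LinearMap.smul_apply]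
  module

/-- Second operator of (D.7.6)'s error on `φ B̲⊗̂B̲` (generic `φ`; EXACT, `⊗̂` symmetric):
`ᶜ∇₄(φB̲⊗̂B̲) + (tr X + (3/2)conj tr X)φB̲⊗̂B̲ = (ᶜ∇₄φ + ((3/2)conj tr X − tr X)φ)B̲⊗̂B̲ + 2φ(ᶜ∇₄B̲ + tr X B̲)⊗̂B̲`.
[cite: GiorgiKlainermanSzeftel2024, p0894 L101–p0895 L5; GiorgiKlainermanSzeftel2022, l.36359–36367, l.36386–36392] -/
theorem D73_BB_second [CharZero K] (hot : M₁ →ₗ[K] M₁ →ₗ[K] M₂) (D : Derivation ℤ K K) (n4 : M₁ →+ M₁)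
    (N4 : CovD D M₂) (y yb φ : K) (Bb : M₁)
    (hprod : ∀ u v, N4.op (hot u v) = hot (n4 u) v + hot u (n4 v)) (hsym : ∀ u v, hot u v = hot v u) :
    N4.op (φ • hot Bb Bb) + ((y + 3 / 2 * yb) * φ) • hot Bb Bb
      = (D φ + (3 / 2 * yb - y) * φ) • hot Bb Bb + (2 * φ) • hot (n4 Bb + y • Bb) Bb := by
  rw [N4.leibniz, hprod, hsym Bb (n4 Bb)]
  simp only [map_add, map_smul, LinearMap.add_apply, LinearMap.smul_apply]
  module

/-- The `B̲⊗̂B̲`-coefficient left by the two operators on the extra term, `φ₂ = conj tr X − (3/2)tr X`: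
under "`ᶜ∇₄tr X = −½(tr X)² + g_y`", "`ᶜ∇₄conj tr X = −½(conj tr X)² + g_yb`",
`ᶜ∇₄φ₂ + ((3/2)conj tr X − tr X)φ₂ = (tr X − conj tr X)((9/4)tr X − conj tr X) + (g_yb − (3/2)g_y)` —
the explicit part carries the factor `tr X − conj tr X = −2i⁽ᵃ⁾tr χ`.  (Kernel data for the
materiality of the sibling's (PD-½); the verdict is the census's.)
[cite: GiorgiKlainermanSzeftel2024, p0893 L78–p0895 L5; GiorgiKlainermanSzeftel2022, l.36332–36392] -/
theorem D73_BB_residue [CharZero K] (D : Derivation ℤ K K) (y yb gy gyb : K)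
    (hDy : D y = -(1 / 2) * y ^ 2 + gy) (hDyb : D yb = -(1 / 2) * yb ^ 2 + gyb) :
    D (yb - 3 / 2 * y) + (3 / 2 * yb - y) * (yb - 3 / 2 * y)
      = (y - yb) * (9 / 4 * y - yb) + (gyb - 3 / 2 * gy) := by
  obtain ⟨D2, -⟩ := D_num D
  simp only [map_sub, D.leibniz, D.leibniz_div, hDy, hDyb, D2, smul_eq_mul, mul_zero, sub_zero]
  have h3 : D (3 : K) = 0 := D_ofNat D 3
  rw [h3]
  ring

/-- Step 2, `J₁ := ᶜ∇₄((conj𝒟·B̲)X̲̂) + (½tr X + conj tr X)(conj𝒟·B̲)X̲̂` (scalar `conj𝒟·B̲ =: d_B` times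
the 2-tensor `X̲̂`).  Inputs: "`[ᶜ∇₄, conj𝒟·]B̲ = −½conj tr X(conj𝒟·B̲) + r⁻³B̲ + …`" (`hcomm`),
"`ᶜ∇₄X̲̂ + ½tr X X̲̂ = r⁻¹Γ_g`" (`hX`), and the Leibniz rule "`conj𝒟·(ᶜ∇₄B̲) = conj𝒟·(ᶜ∇₄B̲ + tr X B̲) −
tr X conj𝒟·B̲ − (conj𝒟 tr X)·B̲`" (`hLeib`).  Output, EXACT: `J₁ = conj𝒟·(ᶜ∇₄B̲ + tr X B̲)X̲̂ −
½conj tr X(conj𝒟·B̲)X̲̂ + [(conj tr X − tr X)(conj𝒟·B̲)X̲̂ − ((conj𝒟 tr X)·B̲)X̲̂] + l.o.t.`; the text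
prints the first two terms, the bracket being its `r⁻³𝔡(Γ_g·Γ_b)` ("`𝒟conj tr X = a²r⁻³ + …`").
[cite: GiorgiKlainermanSzeftel2024, p0895 L60–p0896 L20; GiorgiKlainermanSzeftel2022, l.36409–36435] -/
theorem D73_J1 [CharZero K] (D : Derivation ℤ K K) (N4 : CovD D M₂) (y yb dB dn4B dgB dyB g₁ : K)
    (Xbh gX : M₂) (hcomm : D dB = dn4B - 1 / 2 * yb * dB + g₁)
    (hLeib : dn4B = dgB - y * dB - dyB) (hX : N4.op Xbh = -((1 / 2 * y) • Xbh) + gX) :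
    N4.op (dB • Xbh) + (1 / 2 * y + yb) • (dB • Xbh)
      = dgB • Xbh - (1 / 2 * yb * dB) • Xbh + (((yb - y) * dB) • Xbh - dyB • Xbh)
        + (g₁ • Xbh + dB • gX) := by
  subst hLeib
  rw [N4.leibniz, hcomm, hX]
  module

/-- Step 2, second operator on the schematic `J₁ = conj tr X(conj𝒟·B̲)X̲̂`, EXACT regrouping:
`J₂ = (ᶜ∇₄conj tr X + ½(conj tr X)²)(conj𝒟·B̲)X̲̂ + conj tr X(ᶜ∇₄(conj𝒟·B̲) + (3/2)conj tr X conj𝒟·B̲)X̲̂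
+ conj tr X(conj𝒟·B̲)(ᶜ∇₄X̲̂ + ½tr X X̲̂) + [½conj tr X(tr X − conj tr X)(conj𝒟·B̲)X̲̂]` — the display plus
the bracketed `O(a)` term.
[cite: GiorgiKlainermanSzeftel2024, p0896 L21–47; GiorgiKlainermanSzeftel2022, l.36436–36446] -/
theorem D73_J2 [CharZero K] (D : Derivation ℤ K K) (N4 : CovD D M₂) (y yb dB : K) (Xbh : M₂) :
    N4.op ((yb * dB) • Xbh) + ((y + 3 / 2 * yb) * (yb * dB)) • Xbh
      = ((D yb + 1 / 2 * yb ^ 2) * dB) • Xbh + (yb * (D dB + 3 / 2 * yb * dB)) • Xbh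
        + (yb * dB) • (N4.op Xbh + (1 / 2 * y) • Xbh) + (1 / 2 * yb * (y - yb) * dB) • Xbh := by
  rw [N4.leibniz, D.leibniz]
  simp only [smul_eq_mul]
  module

/-- Step 3, `K₁ := ᶜ∇₄((X̲̂·Ȟ̄)B̲) + (½tr X + conj tr X)(X̲̂·Ȟ̄)B̲` with `U = X̲̂·Ȟ̄` and the Leibniz
expansion "`ᶜ∇₄(X̲̂·Ȟ̄) = (ᶜ∇₄X̲̂ + ½tr X X̲̂)·Ȟ̄ + X̲̂·(ᶜ∇₄Ȟ̄ + ½tr X Ȟ̄) − tr X(X̲̂·Ȟ̄) + l.o.t.`" (`hU`),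
the product `(X̲̂·Ȟ̄)B̲` a bilinear pairing `pr` with product rule `hprod`.  EXACT:
`K₁ = T₁B̲ + T₂B̲ + U(ᶜ∇₄B̲ + tr X B̲) + (conj tr X − (3/2)tr X)UB̲ + l.o.t.`; the displayed coefficient
`−½conj tr X` differs from `conj tr X − (3/2)tr X` by `(3/2)(conj tr X − tr X) = O(a)` (second conjunct).
[cite: GiorgiKlainermanSzeftel2024, p0896 L48–122; GiorgiKlainermanSzeftel2022, l.36448–36463] -/
theorem D73_K1 [CharZero K] (pr : M₁ →ₗ[K] M₁ →ₗ[K] M₂) (n4 : M₁ →+ M₁) (N4 : M₂ →+ M₂) (y yb : K)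
    (U T₁ T₂ gU Bb : M₁) (hprod : ∀ u v, N4 (pr u v) = pr (n4 u) v + pr u (n4 v))
    (hU : n4 U = T₁ + T₂ - y • U + gU) :
    N4 (pr U Bb) + (1 / 2 * y + yb) • pr U Bb
      = pr T₁ Bb + pr T₂ Bb + pr U (n4 Bb + y • Bb) + (yb - 3 / 2 * y) • pr U Bb + pr gU Bb ∧
    (yb - 3 / 2 * y) - (-(1 / 2) * yb) = 3 / 2 * (yb - y) := by
  refine ⟨?_, by ring⟩
  rw [hprod, hU]
  simp only [map_add, map_sub, map_smul, LinearMap.add_apply, LinearMap.sub_apply,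
    LinearMap.smul_apply]
  module

/-- Step 3 with the bracket PRINTED in the `K₁` display, `(ᶜ∇₄B̲ + ½tr X B̲)`: the same exact identity
leaves `(conj tr X − tr X)UB̲`, which differs from the displayed `−½conj tr X UB̲` by `(3/2)conj tr X −
tr X` (not small); with the bracket `(ᶜ∇₄B̲ + tr X B̲)` printed in the `J₂`-display eight lines below
(and in Steps 1–2) the difference is the `O(a)` of `D73_K1` — the "`½tr X`" of this line reads "`tr X`".
Print-level (the display is an intermediate line).
[cite: GiorgiKlainermanSzeftel2024, p0896 L69 vs L116; GiorgiKlainermanSzeftel2022, l.36452 vs l.36460] -/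
theorem D73_K1_printed_bracket [CharZero K] (pr : M₁ →ₗ[K] M₁ →ₗ[K] M₂) (n4 : M₁ →+ M₁) (N4 : M₂ →+ M₂)
    (y yb : K) (U T₁ T₂ gU Bb : M₁) (hprod : ∀ u v, N4 (pr u v) = pr (n4 u) v + pr u (n4 v))
    (hU : n4 U = T₁ + T₂ - y • U + gU) :
    N4 (pr U Bb) + (1 / 2 * y + yb) • pr U Bb
      = pr T₁ Bb + pr T₂ Bb + pr U (n4 Bb + (1 / 2 * y) • Bb) + (yb - y) • pr U Bb + pr gU Bb ∧
    (yb - y) - (-(1 / 2) * yb) = 3 / 2 * yb - y := by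
  refine ⟨?_, by ring⟩
  rw [hprod, hU]
  simp only [map_add, map_sub, map_smul, LinearMap.add_apply, LinearMap.sub_apply,
    LinearMap.smul_apply]
  module

/-- Step 3, second operator on the schematic `K₁ = conj tr X(X̲̂·Ȟ̄)B̲` (printed under the label "`J₂`"),
EXACT: `= (ᶜ∇₄conj tr X + ½(conj tr X)²)UB̲ + conj tr X T₁B̲ + conj tr X T₂B̲ + conj tr X U(ᶜ∇₄B̲ + tr X B̲)
+ [conj tr X(conj tr X − tr X)UB̲] + l.o.t.` — the display plus the bracketed `O(a)` term.
[cite: GiorgiKlainermanSzeftel2024, p0896 L91–124; GiorgiKlainermanSzeftel2022, l.36457–36463] -/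
theorem D73_K2 [CharZero K] (pr : M₁ →ₗ[K] M₁ →ₗ[K] M₂) (D : Derivation ℤ K K) (n4 : M₁ →+ M₁)
    (N4 : CovD D M₂) (y yb : K) (U T₁ T₂ gU Bb : M₁)
    (hprod : ∀ u v, N4.op (pr u v) = pr (n4 u) v + pr u (n4 v)) (hU : n4 U = T₁ + T₂ - y • U + gU) :
    N4.op (yb • pr U Bb) + ((y + 3 / 2 * yb) * yb) • pr U Bb
      = (D yb + 1 / 2 * yb ^ 2) • pr U Bb + yb • pr T₁ Bb + yb • pr T₂ Bb
        + yb • pr U (n4 Bb + y • Bb) + (yb * (yb - y)) • pr U Bb + yb • pr gU Bb := by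
  rw [N4.leibniz, hprod, hU]
  simp only [map_add, map_sub, map_smul, LinearMap.add_apply, LinearMap.sub_apply,
    LinearMap.smul_apply]
  module

/-- Step 5, `L := ᶜ∇₄𝒟⊗̂U + (tr X + (3/2)conj tr X)𝒟⊗̂U`, `U = X̂·conj𝒟A̲`.  Inputs: the commutator
"`[ᶜ∇₄, 𝒟⊗̂]U = −½tr X 𝒟⊗̂U + l.o.t.`" (`hcomm`), the Leibniz rule of `𝒟⊗̂` (`hDL`), the expansion
"`ᶜ∇₄U = (ᶜ∇₄X̂ + Re(tr X)X̂)·conj𝒟A̲ + X̂·conj𝒟ᶜ∇₄A̲ − (Re(tr X) + ½conj tr X)U + l.o.t.`" (`hU`, using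
the null structure `ᶜ∇₄X̂ + Re(tr X)X̂ = −A` and `[ᶜ∇₄, conj𝒟]A̲ = −½conj tr X conj𝒟A̲ + …`),
`Re(tr X) = ½(tr X + conj tr X)` and "`X̂·conj𝒟ᶜ∇₄A̲ = X̂·conj𝒟A̲₄ − ½tr X U − ½X̂·((conj𝒟 tr X)A̲)`"
(`hX4`, from `ᶜ∇₄A̲ = A̲₄ − ½tr X A̲`).  Output: `L = 𝒟⊗̂((ᶜ∇₄X̂ + Re X̂)·conj𝒟A̲) + 𝒟⊗̂(X̂·conj𝒟A̲₄) +
½(conj tr X − tr X)𝒟⊗̂U − 𝒟(tr X + conj tr X)⊗̂U − ½𝒟⊗̂(X̂·((conj𝒟 tr X)A̲)) + l.o.t.`: the display's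
`−½conj tr X 𝒟⊗̂U + conj tr X 𝒟⊗̂U` followed by the substitution of `ᶜ∇₄A̲` leaves the `O(a)`
coefficient `½(conj tr X − tr X)` on `𝒟⊗̂U`.
[cite: GiorgiKlainermanSzeftel2024, p0897 L10–96; GiorgiKlainermanSzeftel2022, l.36472–36497] -/
theorem D73_L [CharZero K] (hot : M₁ →ₗ[K] M₁ →ₗ[K] M₂) (Dhat : M₁ →+ M₂) (Dh : Derivation ℤ K M₁)
    (n4 : M₁ →+ M₁) (y yb re : K) (U mAW XcDn4A XcDA4 XyA gU : M₁) (n4DhU g₅ : M₂)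
    (hDL : ∀ (f : K) (u : M₁), Dhat (f • u) = f • Dhat u + hot (Dh f) u)
    (hcomm : n4DhU = Dhat (n4 U) - (1 / 2 * y) • Dhat U + g₅)
    (hU : n4 U = mAW + XcDn4A - (re + 1 / 2 * yb) • U + gU) (hre : re = 1 / 2 * (y + yb))
    (hX4 : XcDn4A = XcDA4 - (1 / 2 * y) • U - (1 / 2 : K) • XyA) :
    n4DhU + (y + 3 / 2 * yb) • Dhat U
      = Dhat mAW + Dhat XcDA4 + (1 / 2 * (yb - y)) • Dhat U - hot (Dh y + Dh yb) U
        - (1 / 2 : K) • Dhat XyA + (Dhat gU + g₅) := by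
  obtain ⟨-, -, -, hhalf, -⟩ := Dv_num Dh
  subst hcomm hre hX4
  rw [hU]
  simp only [map_add, map_sub, hDL, Dh.leibniz, hhalf, smul_zero, add_zero, map_smul,
    LinearMap.add_apply, LinearMap.smul_apply, map_zero, LinearMap.zero_apply]
  module

/-- Step 6, the one-form `ᶜ∇₄(X̂·Ȟ) + (3/2)tr X(X̂·Ȟ)` with the Leibniz expansion "`ᶜ∇₄(X̂·Ȟ) =
(ᶜ∇₄X̂ + Re(tr X)X̂)·Ȟ + X̂·(ᶜ∇₄Ȟ + ½conj tr X Ȟ) − (Re(tr X) + ½conj tr X)(X̂·Ȟ) + l.o.t.`":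
`= P₁ + P₂ + (tr X − conj tr X)(X̂·Ȟ) + l.o.t.` — the display plus the `O(a)` multiple
(`(3/2)tr X − Re(tr X) − ½conj tr X = tr X − conj tr X`).
[cite: GiorgiKlainermanSzeftel2024, p0897 L97–p0898 L6; GiorgiKlainermanSzeftel2022, l.36499–36514] -/
theorem D73_M [CharZero K] (n4 : M₁ →+ M₁) (y yb re : K) (XhHc P₁ P₂ g : M₁)
    (hn4 : n4 XhHc = P₁ + P₂ - (re + 1 / 2 * yb) • XhHc + g) (hre : re = 1 / 2 * (y + yb)) :
    n4 XhHc + (3 / 2 * y) • XhHc = P₁ + P₂ + (y - yb) • XhHc + g := by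
  subst hre
  rw [hn4]
  module

end PropD73

end Literature.Geometry.Lorentzian.GiorgiKlainermanSzeftel2022.TeukolskyQfbLedger
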